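import Literature.Computability.QuantumComplexity.ZOmegaCramer
import Literature.Computability.QuantumComplexity.StabilizerProjectorWords
import Literature.Computability.QuantumComplexity.GadgetizeList
import Literature.Computability.QuantumComplexity.CliffordAmplitudeFP
import Literature.Computability.QuantumComplexity.SharpPHadamardCore
import Literature.Computability.QuantumComplexity.RevCleanSize
import HarnessLib

/-!
# Polynomial exact stabilizer rank of `|T⟩^{⊗m}` gives a polynomial-size advice datum for `#P` counts

Topic `Literature/Computability/QuantumComplexity`; fifth support file — the mathematics of the
advice — for the discharge of the named fact
`MehrabanTahmasbi2024_PSharpP_subset_PPoly_of_stabilizerRank_poly` (`StabilizerRankPermanent.lean`;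
S. Mehraban, M. Tahmasbi, *Quadratic lower bounds on the approximate stabilizer rank: a probabilistic
approach*, STOC 2024 = arXiv:2305.10277, Thm. 1.6). The printed proof (arXiv p. 5–6):

> "if `χ(T^{⊗m}) = poly(m)`, there exists a polynomial-time algorithm with polynomial advice … for
> the problem of computing the gap of a polynomial-size classical circuit. … let `U_f` be a reversible
> implementation … `⟨0ⁿ1|H^{⊗n+1} U_f H^{⊗n}⊗I|0^{n+1}⟩ = gap(f)/(√2 2ⁿ)` … compile this circuit into
> Clifford and `T` gates … `2^{m/2}⟨0ⁿ1|⊗⟨0^m| C_f |0^{n+1}⟩⊗|T^{⊗m}⟩ = gap(f)/(√2 2ⁿ)` …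
> `T^{⊗m} = Σᵢ cᵢ φᵢ` … polynomial number of bits of advice to represent `c₁, …, c_r` [and] the full
> description of `φ₁, …, φ_r` … Using the Gottesman–Knill algorithm, we can find each
> `⟨0ⁿ1|⊗⟨0^m| C_f ⊗ I |0^{n+1}⟩⊗|φᵢ⟩` in polynomial time and evaluate the whole sum."

This file assembles the tree's versions of these steps into ONE statement about data:
for the Hadamard-test core `Q` of a `#P` relation (`SharpPHadamardCore.lean`: the amplitude of
`yfin y` is `(1/√2)^{ρ+|S₂|}(2^ρ - 2 #witnesses)`), gadgetization with an explicit Clifford list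
(`GadgetizeList.lean`), a MINIMAL stabilizer decomposition of `|T⟩^{⊗t}` (minimal ⇒ linearly
independent, `linearIndependent_of_card_eq_stabilizerRank`), the phase-exact gadget words of its
states (`StabilizerProjectorWords.lean`), the integrality of scaled Clifford amplitudes and the exact
Gauss-sum evaluator (`CliffordAmplitudeFP.lean`), Cramer's rule over `ℤ[ω]` with coordinate bounds
(`ZOmegaCramer.lean`), we obtain (**`SharpPHT.Core.advice_spec`**): under
`χ(|T⟩^{⊗m}) ≤ m^c + c` there is a polynomial `P` and for every length `n` an ADVICE DATUM
`advOf Q n` (`structure AdvDatum`: merged gate codes, label tails and integral coefficients of the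
terms, and the constants of a closed formula) whose code has length `≤ P(n)` and which EVALUATES — by
running the exact amplitude evaluator `ampValOf` on each item and applying the integer formula
`countOf` — to `#{w ∈ {0,1}^{p(n)} | ⟨y, w⟩ ∈ R}` for every query `y` of length `n`
(`eval_advOf`). The sequel (`StabilizerRankPermanentProofs.lean`) turns `AdvDatum.eval` into a
polynomial-time machine and concludes `P^{#P} ⊆ P/poly`.

Contents: §1 the master register `(N+t)+t`, `magicEmb`, the overlap sum and `merge_amplitude`;
`gadgetizeListLen`; §2 minimal decompositions are independent, `|T⟩^{⊗t}` pointwise, `ω`, `√2` in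
`ℤ[ω]`, **`exists_integral_decomposition`** (`Σ aᵢ uᵢ = D ω^{|x|}`); §3 the chosen per-length data
(`cList`, `decomp`, `mList`, `termVal`, `sumS`) and the **master identity** `master_complex`
(`gap · val D · (1/√2)^{2ρ+A₁} = (1/√2)^{h_C}(1/2)^W val S`); §4 the identity in `ℤ[ω]`
(`master_zomega`), the gap as an exact integer quotient (`gap_eq_div`, via the norm), the labels as
bit lists (`yfin_eq_append`), `AdvDatum`, `advOf`, **`eval_advOf`**; §5–6 codes (`zoE`, `itemE`,
`advE`), coordinate bounds and the polynomial size bound (`exists_poly_length_advE`), `advice_spec`.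

What is NOT here: any complexity class; the machine reading `advE` (sequel).

## References

* S. Mehraban, M. Tahmasbi, arXiv:2305.10277 (STOC 2024), Thm. 1.6 and its proof (p. 5–6), Remark 1.7.
* S. Bravyi et al., Quantum 3 (2019) 181, §2.3.1 eqs. (15)–(16) (gadgetization).
* S. Aaronson, D. Gottesman, PRA 70 (2004) 052328, §III; S. Bravyi, D. Gosset, PRL 116 (2016) 250501,
  App. A–C (strong simulation of Clifford circuits).
* M. A. Nielsen, I. L. Chuang, *Quantum Computation and Quantum Information*, CUP 2010, §4.3, §10.5.
* S. Arora, B. Barak, *Computational Complexity*, CUP 2009, §6.3 (advice), §17.2 (`#P`, gaps).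
-/

noncomputable section

/-! ### The master register `(N + t) + t` and the two placements -/

namespace Literature.Computability.QuantumComplexity

namespace StabilizerFormalism

open _root_.Computability Cryptography Matrix BravyiGosset

variable {N t : ℕ}

/-- The embedding of the gadget register (`t` magic wires, then `t` gadget ancillas) into the master
register `(N + t) + t`: wire `j` goes to wire `N + j`. [folklore] -/
def magicEmb (N t : ℕ) : Fin (t + t) ↪ Fin (N + t + t) :=
  ⟨fun j => Fin.addCases (fun j' => Fin.castAdd t (Fin.natAdd N j')) (fun j'' => Fin.natAdd (N + t) j'') j, by
    intro a b h
    induction a using Fin.addCases with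
    | left a =>
      induction b using Fin.addCases with
      | left b =>
        simp only [Fin.addCases_left] at h
        have := congrArg Fin.val h; simp at this; exact Fin.ext (by simp; omega)
      | right b =>
        simp only [Fin.addCases_left, Fin.addCases_right] at h
        have := congrArg Fin.val h; simp at this; omega
    | right a =>
      induction b using Fin.addCases with
      | left b =>
        simp only [Fin.addCases_left, Fin.addCases_right] at h
        have := congrArg Fin.val h; simp at this; omega
      | right b =>
        simp only [Fin.addCases_right] at h
        have := congrArg Fin.val h; simp at this; exact Fin.ext (by simp; omega)⟩

/-- `magicEmb` on a magic wire. [folklore] -/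
@[simp] theorem magicEmb_castAdd (j : Fin t) : magicEmb N t (Fin.castAdd t j) = Fin.castAdd t (Fin.natAdd N j) := by
  simp only [magicEmb, Function.Embedding.coeFn_mk, Fin.addCases_left]

/-- `magicEmb` on a gadget ancilla. [folklore] -/
@[simp] theorem magicEmb_natAdd (j : Fin t) : magicEmb N t (Fin.natAdd t j) = Fin.natAdd (N + t) j := by
  simp only [magicEmb, Function.Embedding.coeFn_mk, Fin.addCases_right]

/-- The value of `magicEmb j` is `N + j`. [folklore] -/
theorem val_magicEmb (j : Fin (t + t)) : (magicEmb N t j : ℕ) = N + j := by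
  induction j using Fin.addCases with
  | left j => rw [magicEmb_castAdd, Fin.val_castAdd, Fin.val_natAdd, Fin.val_castAdd]
  | right j => rw [magicEmb_natAdd, Fin.val_natAdd, Fin.val_natAdd]; omega

/-- A master label from its three blocks. [folklore] -/
abbrev lab3 (a : QReg N) (v s : QReg t) : QReg (N + t + t) := Fin.append (Fin.append a v) s

/-- Restriction of a master label to the circuit register (first two blocks). [folklore] -/
theorem lab3_comp_castAddEmb (a : QReg N) (v s : QReg t) : (lab3 a v s) ∘ Fin.castAddEmb t = Fin.append a v := by
  funext i; simp [lab3]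

/-- Restriction of a master label to the gadget register (last two blocks). [folklore] -/
theorem lab3_comp_magicEmb (a : QReg N) (v s : QReg t) : (lab3 a v s) ∘ magicEmb N t = Fin.append v s := by
  funext j
  induction j using Fin.addCases with
  | left j => rw [Function.comp_apply, magicEmb_castAdd]; show Fin.append _ s _ = _; rw [Fin.append_left, Fin.append_right, Fin.append_left]
  | right j => rw [Function.comp_apply, magicEmb_natAdd]; show Fin.append _ s _ = _; rw [Fin.append_right, Fin.append_right]

/-- Wires outside the circuit register are the gadget ancillas. [folklore] -/
theorem not_mem_range_castAddEmb_iff (i : Fin (N + t + t)) :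
    i ∉ Set.range (Fin.castAddEmb t : Fin (N + t) ↪ Fin (N + t + t)) ↔ ∃ j : Fin t, i = Fin.natAdd (N + t) j := by
  constructor
  · intro h
    induction i using Fin.addCases with
    | left i => exact absurd ⟨i, rfl⟩ h
    | right j => exact ⟨j, rfl⟩
  · rintro ⟨j, rfl⟩ ⟨i, hi⟩
    have := congrArg Fin.val hi; simp at this; omega

/-- Wires outside the gadget register are the input wires. [folklore] -/
theorem not_mem_range_magicEmb_iff (i : Fin (N + t + t)) :
    i ∉ Set.range (magicEmb N t) ↔ ∃ a : Fin N, i = Fin.castAdd t (Fin.castAdd t a) := by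
  constructor
  · intro h
    induction i using Fin.addCases with
    | left i =>
      induction i using Fin.addCases with
      | left a => exact ⟨a, rfl⟩
      | right j => exact absurd ⟨Fin.castAdd t j, magicEmb_castAdd j⟩ h
    | right j => exact absurd ⟨Fin.natAdd t j, magicEmb_natAdd j⟩ h
  · rintro ⟨a, rfl⟩ ⟨j, hj⟩
    have := congrArg Fin.val hj
    rw [val_magicEmb] at this
    simp at this; omega

/-- **The overlap sum.** For the circuit `Cm` placed on the first `N + t` wires and the gadget word
`G` placed on the last `t + t` wires:
`(Cm_{e₁} G_{e₂})[(f, 0, 0), (a₀, z, 0)] = Σ_v Cm[(f, 0), (a₀, v)] · G[(v, 0), (z, 0)]`.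
[cite: NielsenChuang2010, §4.3] -/
theorem placeGate_mul_placeGate_apply_lab3 (Cm : Matrix (QReg (N + t)) (QReg (N + t)) ℂ)
    (G : Matrix (QReg (t + t)) (QReg (t + t)) ℂ) (f a₀ : QReg N) (z : QReg t) :
    (placeGate (Fin.castAddEmb t) Cm * placeGate (magicEmb N t) G) (lab3 f (fun _ => false) (fun _ => false))
        (lab3 a₀ z (fun _ => false)) =
      ∑ v : QReg t, Cm (Fin.append f fun _ => false) (Fin.append a₀ v) *
        G (Fin.append v fun _ => false) (Fin.append z fun _ => false) := by
  rw [Matrix.mul_apply, sum_qReg_add, sum_qReg_add]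
  -- only `a = a₀` contributes
  rw [Finset.sum_eq_single a₀]
  · refine Finset.sum_congr rfl fun v _ => ?_
    -- only `s = 0` contributes
    rw [Finset.sum_eq_single (fun _ : Fin t => false)]
    · rw [placeGate_apply, if_pos, placeGate_apply, if_pos]
      · show Cm (lab3 f _ _ ∘ Fin.castAddEmb t) (lab3 a₀ v _ ∘ Fin.castAddEmb t) *
          G (lab3 a₀ v _ ∘ magicEmb N t) (lab3 a₀ z _ ∘ magicEmb N t) = _
        rw [lab3_comp_castAddEmb, lab3_comp_castAddEmb, lab3_comp_magicEmb, lab3_comp_magicEmb]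
      · intro i hi
        obtain ⟨a, rfl⟩ := (not_mem_range_magicEmb_iff i).1 hi
        simp [lab3]
      · intro i hi
        obtain ⟨j, rfl⟩ := (not_mem_range_castAddEmb_iff i).1 hi
        simp [lab3]
    · intro s _ hs
      rw [placeGate_apply, if_neg, zero_mul]
      intro h
      apply hs
      funext j
      have := h (Fin.natAdd (N + t) j) ((not_mem_range_castAddEmb_iff _).2 ⟨j, rfl⟩)
      simp [lab3] at this
      exact this
    · intro h; exact absurd (Finset.mem_univ _) h
  · intro a _ ha
    refine Finset.sum_eq_zero fun v _ => Finset.sum_eq_zero fun s _ => ?_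
    rw [placeGate_apply (magicEmb N t), if_neg, mul_zero]
    intro h
    apply ha
    funext i
    have := h (Fin.castAdd t (Fin.castAdd t i)) ((not_mem_range_magicEmb_iff _).2 ⟨i, rfl⟩)
    simp [lab3] at this
    exact this
  · intro h; exact absurd (Finset.mem_univ _) h

/-- **The merged gate list**: the gadget word transported onto the gadget register, then the circuit
transported onto the circuit register; its matrix is the product of the two placements.
[cite: NielsenChuang2010, §4.3] -/
theorem prodZeta_merge (L₂ : List (QGate cliffordT (t + t))) (h₂ : ∀ g ∈ L₂, g.IsOracleFree)
    (L₁ : List (QGate cliffordT (N + t))) (h₁ : ∀ g ∈ L₁, g.IsOracleFree) :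
    prodZeta omega (L₂.map (mapWiresGate (magicEmb N t)) ++ L₁.map (mapWiresGate (Fin.castAddEmb t))) =
      placeGate (Fin.castAddEmb t) (prodZeta omega L₁) * placeGate (magicEmb N t) (prodZeta omega L₂) := by
  have ho₁ : (⟨L₁.map (mapWiresGate (Fin.castAddEmb t))⟩ : QCircuit cliffordT (N + t + t)).IsOracleFree :=
    fun g hg => by obtain ⟨g', hg', rfl⟩ := List.mem_map.1 hg; exact isOracleFree_mapWiresGate _ (h₁ g' hg')
  have ho₂ : (⟨L₂.map (mapWiresGate (magicEmb N t))⟩ : QCircuit cliffordT (N + t + t)).IsOracleFree :=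
    fun g hg => by obtain ⟨g', hg', rfl⟩ := List.mem_map.1 hg; exact isOracleFree_mapWiresGate _ (h₂ g' hg')
  rw [prodZeta_append, prodZeta_omega 0 ho₁, prodZeta_omega 0 ho₂, toMatrix_map_mapWiresGate, toMatrix_map_mapWiresGate,
    ← prodZeta_omega 0 (show (⟨L₁⟩ : QCircuit cliffordT (N + t)).IsOracleFree from h₁),
    ← prodZeta_omega 0 (show (⟨L₂⟩ : QCircuit cliffordT (t + t)).IsOracleFree from h₂)]

/-- **The merged amplitude.** [cite: NielsenChuang2010, §4.3] -/
theorem merge_amplitude (L₂ : List (QGate cliffordT (t + t))) (h₂ : ∀ g ∈ L₂, g.IsOracleFree)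
    (L₁ : List (QGate cliffordT (N + t))) (h₁ : ∀ g ∈ L₁, g.IsOracleFree) (f a₀ : QReg N) (z : QReg t) :
    (prodZeta omega (L₂.map (mapWiresGate (magicEmb N t)) ++ L₁.map (mapWiresGate (Fin.castAddEmb t))) *ᵥ
        basisState (lab3 a₀ z (fun _ => false))) (lab3 f (fun _ => false) (fun _ => false)) =
      ∑ v : QReg t, prodZeta omega L₁ (Fin.append f fun _ => false) (Fin.append a₀ v) *
        (prodZeta omega L₂ *ᵥ basisState (Fin.append z fun _ => false)) (Fin.append v fun _ => false) := by
  rw [prodZeta_merge L₂ h₂ L₁ h₁, mulVec_basisState]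
  dsimp only
  rw [placeGate_mul_placeGate_apply_lab3]
  refine Finset.sum_congr rfl fun v _ => ?_
  rw [mulVec_basisState]

/-! ### Gadgetization with an explicit gate list, keeping the length -/

/-- `gadgetizeList` with the extra information that the Clifford list has as many gates as the
original list (one gate per gate). [cite: BravyiEtAl2019, §2.3.1 eq. (16)] -/
theorem gadgetizeListLen (A : Language Bool) :
    ∀ (L : List (QGate cliffordT N)), (∀ g ∈ L, g.IsOracleFree) → ∀ t : ℕ,
      (⟨L⟩ : QCircuit cliffordT N).tCount = t →
        ∃ C : List (QGate cliffordT (N + t)), (∀ g ∈ C, g.IsOracleFree) ∧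
          (⟨C⟩ : QCircuit cliffordT (N + t)).tCount = 0 ∧ C.length = L.length ∧
          ∀ ψ : QReg N → ℂ, (⟨L⟩ : QCircuit cliffordT N).toMatrix A *ᵥ ψ =
            (invSqrt2⁻¹ ^ t) • projZ t ((⟨C⟩ : QCircuit cliffordT (N + t)).toMatrix A *ᵥ tensorVec ψ (tensorPow magicT t))
  | [], _, t, ht => by
    rw [QCircuit.tCount_nil] at ht
    subst ht
    refine ⟨[], fun _ h => absurd h List.not_mem_nil, rfl, rfl, fun ψ => ?_⟩
    rw [QCircuit.toMatrix_nil, Matrix.one_mulVec, Matrix.one_mulVec, pow_zero, one_smul,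
      projZ_zero_tensorVec_tensorPow_zero]
  | QGate.oracle k e :: L, hof, t, _ => absurd (hof _ List.mem_cons_self) id
  | QGate.gate g e :: L, hof, t, ht => by
    have hofL : ∀ g' ∈ L, QGate.IsOracleFree g' := fun g' hg' => hof g' (List.mem_cons_of_mem _ hg')
    rw [QCircuit.tCount_cons] at ht
    cases g with
    | T =>
      rw [QGate.isT_gate_T, if_pos rfl] at ht
      subst ht
      obtain ⟨C, hC, hC0, hlen, hV⟩ := gadgetizeListLen A L hofL _ rfl
      refine ⟨tStepList _ (embT e 0) C, ?_, ?_, ?_, fun ψ => ?_⟩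
      · intro g hg
        rcases List.mem_cons.1 hg with rfl | hg
        · exact trivial
        · exact isOracleFree_map_mapWiresGate _ hC g hg
      · rw [show ((⟨tStepList _ (embT e 0) C⟩ : QCircuit cliffordT _).tCount) =
            (⟨C.map (mapWiresGate (Fin.castAddEmb 1))⟩ : QCircuit cliffordT _).tCount + 0 from QCircuit.tCount_cons _ _,
          tCount_map_mapWiresGate, hC0]
      · show (C.map (mapWiresGate (Fin.castAddEmb 1))).length + 1 = L.length + 1
        rw [List.length_map, hlen]
      · rw [QCircuit.toMatrix_cons, QGate.toMatrix_gate,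
          show placeGate e (cliffordT.mat CliffordTOp.T) = placeGate (wireEmb (embT e 0)) tGate from
            congrArg (fun f : Fin 1 ↪ Fin N => placeGate f tGate) (emb_one_eq_wireEmb (embT e)),
          gadgetizeList_T_step A (embT e 0) hV, pow_succ]
    | H =>
      rw [QGate.isT_gate_H] at ht
      simp only [Bool.false_eq_true, if_false, add_zero] at ht
      obtain ⟨C, hC, hC0, hlen, hV⟩ := gadgetizeListLen A L hofL t ht
      refine ⟨_, ?_, ?_, ?_, gadgetizeList_clifford_step A _ hV⟩
      · intro g hg
        rcases List.mem_cons.1 hg with rfl | hg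
        · exact trivial
        · exact hC g hg
      · rw [QCircuit.tCount_cons, hC0]; rfl
      · rw [List.length_cons, List.length_cons, hlen]
    | S =>
      rw [QGate.isT_gate_S] at ht
      simp only [Bool.false_eq_true, if_false, add_zero] at ht
      obtain ⟨C, hC, hC0, hlen, hV⟩ := gadgetizeListLen A L hofL t ht
      refine ⟨_, ?_, ?_, ?_, gadgetizeList_clifford_step A _ hV⟩
      · intro g hg
        rcases List.mem_cons.1 hg with rfl | hg
        · exact trivial
        · exact hC g hg
      · rw [QCircuit.tCount_cons, hC0]; rfl
      · rw [List.length_cons, List.length_cons, hlen]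
    | CNOT =>
      rw [QGate.isT_gate_CNOT] at ht
      simp only [Bool.false_eq_true, if_false, add_zero] at ht
      obtain ⟨C, hC, hC0, hlen, hV⟩ := gadgetizeListLen A L hofL t ht
      refine ⟨_, ?_, ?_, ?_, gadgetizeList_clifford_step A _ hV⟩
      · intro g hg
        rcases List.mem_cons.1 hg with rfl | hg
        · exact trivial
        · exact hC g hg
      · rw [QCircuit.tCount_cons, hC0]; rfl
      · rw [List.length_cons, List.length_cons, hlen]

/-- Components of the code of an oracle-free Clifford+`T` gate on `R` wires: symbol `≤ 3`, at most
two wires, every wire `< R`. [folklore] -/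
theorem gateTriple_small {R : ℕ} (g : QGate cliffordT R) (hg : g.IsOracleFree) :
    (gateTriple g).2.1 ≤ 3 ∧ (gateTriple g).2.2.length ≤ 2 ∧ ∀ w ∈ (gateTriple g).2.2, w < R := by
  cases g with
  | oracle k e => exact absurd hg id
  | gate op e =>
    refine ⟨?_, ?_, ?_⟩
    · show Encodable.encode op ≤ 3
      cases op <;> decide
    · show (List.ofFn fun i => ((e i : Fin R) : ℕ)).length ≤ 2
      rw [List.length_ofFn]; cases op <;> decide
    · intro w hw
      change w ∈ List.ofFn (fun i => ((e i : Fin R) : ℕ)) at hw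
      rw [List.mem_ofFn] at hw
      obtain ⟨i, rfl⟩ := hw
      exact (e i).2

end StabilizerFormalism

end Literature.Computability.QuantumComplexity

/-! ### The integral decomposition of `√2^t |T⟩^{⊗t}` over the gadget states -/

namespace Literature.Computability.QuantumComplexity

namespace StabilizerFormalism

open _root_.Computability Cryptography Matrix Complex BravyiGosset

/-! #### Minimal decompositions are linearly independent -/

/-- **A stabilizer decomposition with `χ(ψ)` terms is linearly independent** ("otherwise the
decomposition of `|T⟩^{⊗m}` would not be minimal", Mehraban–Tahmasbi 2024, proof of Thm. 1.6).
[cite: MehrabanTahmasbi2024, proof of Theorem 1.6 (arXiv p. 6)] -/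
theorem linearIndependent_of_card_eq_stabilizerRank {n r : ℕ} {ψ : QReg n → ℂ} (c : Fin r → ℂ)
    (φ : Fin r → QReg n → ℂ) (hφ : ∀ i, φ i ∈ stabilizerStates n) (h : ψ = ∑ i, c i • φ i)
    (hr : stabilizerRank ψ = r) : LinearIndependent ℂ φ := by
  classical
  by_contra hli
  obtain ⟨g, hg, k, hk⟩ := Fintype.not_linearIndependent_iff.1 hli
  -- `φ k` in terms of the others
  have e1 : φ k = ∑ i ∈ Finset.univ.erase k, (-(g i / g k)) • φ i := by
    have hsplit := Finset.add_sum_erase Finset.univ (fun i => g i • φ i) (Finset.mem_univ k)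
    rw [hg] at hsplit
    have e0 : g k • φ k = -∑ i ∈ Finset.univ.erase k, g i • φ i := eq_neg_of_add_eq_zero_left hsplit
    have e : φ k = (g k)⁻¹ • -∑ i ∈ Finset.univ.erase k, g i • φ i := by
      rw [← e0, smul_smul, inv_mul_cancel₀ hk, one_smul]
    rw [e, smul_neg, Finset.smul_sum, ← Finset.sum_neg_distrib]
    refine Finset.sum_congr rfl fun i _ => ?_
    rw [smul_smul, neg_smul, div_eq_inv_mul]
  -- `ψ` with `r - 1` terms
  have e2 : ψ = ∑ i ∈ Finset.univ.erase k, (c i + c k * -(g i / g k)) • φ i := by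
    rw [h, ← Finset.add_sum_erase Finset.univ (fun i => c i • φ i) (Finset.mem_univ k)]
    rw [e1, Finset.smul_sum, ← Finset.sum_add_distrib]
    refine Finset.sum_congr rfl fun i _ => ?_
    rw [add_smul, smul_smul, add_comm]
  have e3 : ψ = ∑ i : {i : Fin r // i ≠ k}, (c i + c k * -(g i / g k)) • φ i := by
    rw [e2, Finset.sum_subtype (Finset.univ.erase k) (p := fun i => i ≠ k) (fun i => by simp)]
  have hle := stabilizerRank_le_card (ι := {i : Fin r // i ≠ k}) (fun i => c i + c k * -(g i / g k))
    (fun i => φ i) (fun i => hφ i) e3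
  rw [hr, Fintype.card_subtype_compl, Fintype.card_fin, Fintype.card_unique] at hle
  have : 0 < r := Fin.pos k
  omega

/-! #### `|T⟩^{⊗t}` pointwise and `ω` in `ℤ[ω]` -/

/-- The number of `1`s of a label. [folklore] -/
def ones {t : ℕ} (x : QReg t) : ℕ := ∑ i, Bool.toNat (x i)

/-- `ones` of an extended label. [folklore] -/
theorem ones_succ {t : ℕ} (x : QReg (t + 1)) : ones x = ones (Fin.init x) + Bool.toNat (x (Fin.last t)) := by
  unfold ones; rw [Fin.sum_univ_castSucc]; rfl

/-- **`|T⟩^{⊗t}(x) = (1/√2)^t ω^{|x|}`.** [cite: BravyiGosset2016, eq. (2)] -/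
theorem tensorPow_magicT_apply : ∀ (t : ℕ) (x : QReg t), tensorPow magicT t x = invSqrt2 ^ t * omega ^ ones x
  | 0, x => by simp [tensorPow, ones]
  | t + 1, x => by
    rw [CliffordSim.tensorPow_succ_apply, tensorPow_magicT_apply t (Fin.init x), CliffordSim.magicT_apply, ones_succ, pow_add,
      pow_succ]
    cases x (Fin.last t) <;> simp <;> ring

/-- `ω` as an element of `ℤ[ω]`. [folklore] -/
def omegaZ : ZOmega := ⟨0, 1⟩

/-- `val ω = ω`. [folklore] -/
@[simp] theorem val_omegaZ : ZOmega.val omegaZ = omega := by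
  rw [ZOmega.val_apply]; simp [omegaZ]

/-- `ω⁸ = 1` in `ℤ[ω]`. [folklore] -/
theorem omegaZ_pow_eight : omegaZ ^ 8 = 1 := by
  apply ZOmega.val_injective
  rw [map_pow, val_omegaZ, map_one, omega_pow_eight]

/-- The coordinates of the powers of `ω` are `0, ±1`. [folklore] -/
theorem cn_omegaZ_pow_le (k : ℕ) : ZOmega.cn (omegaZ ^ k) ≤ 1 := by
  rw [← Nat.mod_add_div k 8, pow_add, pow_mul, omegaZ_pow_eight, one_pow, mul_one]
  have h8 : k % 8 < 8 := Nat.mod_lt _ (by norm_num)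
  have h2 : omegaZ ^ 2 = ⟨ZOmega.gi, 0⟩ := by ext <;> simp [pow_succ, omegaZ, ZOmega.gi]
  have h4 : omegaZ ^ 4 = -1 := by
    rw [show (4 : ℕ) = 2 + 2 by rfl, pow_add, h2]; ext <;> simp [ZOmega.gi]
  interval_cases (k % 8)
  · simp
  · simp [omegaZ, ZOmega.cn]
  · rw [h2]; simp [ZOmega.cn, ZOmega.gi]
  · rw [show (3 : ℕ) = 2 + 1 by rfl, pow_add, h2, pow_one]; simp [ZOmega.cn, ZOmega.gi, omegaZ]
  · rw [h4]; simp [ZOmega.cn]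
  · rw [show (5 : ℕ) = 4 + 1 by rfl, pow_add, h4, pow_one]; simp [ZOmega.cn, omegaZ]
  · rw [show (6 : ℕ) = 4 + 2 by rfl, pow_add, h4, h2]; simp [ZOmega.cn, ZOmega.gi]
  · rw [show (7 : ℕ) = 4 + (2 + 1) by rfl, pow_add, pow_add, h4, h2, pow_one]; simp [ZOmega.cn, ZOmega.gi, omegaZ]

/-- `√2 = ω - ω³` in `ℤ[ω]`. [folklore] -/
def sq2Z : ZOmega := omegaZ - omegaZ ^ 3

/-- `val √2 = 1/invSqrt2 = √2`. [folklore] -/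
theorem val_sq2Z : ZOmega.val sq2Z = invSqrt2⁻¹ := by
  rw [sq2Z, map_sub, map_pow, val_omegaZ]
  calc omega - omega ^ 3 = 2 * invSqrt2 := by rw [invSqrt2_eq_omega]; ring
    _ = invSqrt2⁻¹ := eq_inv_of_mul_eq_one_left (by rw [mul_assoc, invSqrt2_mul_invSqrt2]; norm_num)

/-- A Gaussian integer as an element of `ℤ[ω]`. [folklore] -/
def ofGauss (g : GaussianInt) : ZOmega := ⟨g, 0⟩

/-- `val (ofGauss g) = g`. [folklore] -/
@[simp] theorem val_ofGauss (g : GaussianInt) : ZOmega.val (ofGauss g) = (g : ℂ) := by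
  rw [ZOmega.val_apply]; simp [ofGauss]

/-- The coordinates of `ofGauss g`. [folklore] -/
theorem cn_ofGauss_le {g : GaussianInt} {B : ℕ} (h₁ : g.re.natAbs ≤ B) (h₂ : g.im.natAbs ≤ B) :
    ZOmega.cn (ofGauss g) ≤ B := by
  rw [ZOmega.cn_le_iff]; simp [ofGauss, h₁, h₂]

/-! #### The integral decomposition -/

variable {t : ℕ}

/-- **The integral decomposition of `√2^t |T⟩^{⊗t}` over gadget states.** Assume
`χ(|T⟩^{⊗t}) = r`. Then there are gadget data `dᵢ`, labels `zᵢ` (`i < r`), integral vectors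
`uᵢ : {0,1}^t → ℤ[ω]` with `val (uᵢ x) = √2^{hᵢ} · (U_{Gᵢ} |zᵢ 0^t⟩)(x, 0^t)` (`hᵢ` the Hadamard
count of the gadget word `Gᵢ = allGadgets dᵢ`) and coordinates `≤ 2^{t(4t+5)}`, and
`D, a₁, …, a_r ∈ ℤ[ω]` with `val D ≠ 0`, coordinates `≤ r! 4^r 2^{t(4t+5) r}`, such that
`Σᵢ aᵢ uᵢ(x) = D · ω^{|x|}` for every `x` (note `ω^{|x|} = √2^t |T⟩^{⊗t}(x)`). This is Cramer's rule
applied to a minimal (hence linearly independent) stabilizer decomposition of `|T⟩^{⊗t}` whose states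
are presented phase-exactly by gadget words. [cite: MehrabanTahmasbi2024, proof of Theorem 1.6 (arXiv p. 6)] -/
theorem exists_integral_decomposition {r : ℕ} (hr : stabilizerRank (tensorPow magicT t) = r) :
    ∃ (d : Fin r → Fin t → ℕ × QReg t × QReg t) (z : Fin r → QReg t) (u : Fin r → QReg t → ZOmega)
      (D : ZOmega) (a : Fin r → ZOmega),
      (∀ i x, ZOmega.val (u i x) = invSqrt2⁻¹ ^ hCount (allGadgets (d i)) *
        (prodZeta omega (allGadgets (d i)) *ᵥ basisState (Fin.append (z i) (zlab t))) (Fin.append x (zlab t))) ∧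
      (∀ i x, ZOmega.cn (u i x) ≤ 2 ^ (t * (4 * t + 5))) ∧
      ZOmega.val D ≠ 0 ∧
      (∀ x, ∑ i, a i * u i x = D * omegaZ ^ ones x) ∧
      ZOmega.cn D ≤ r.factorial * (4 ^ r * (2 ^ (t * (4 * t + 5))) ^ r) ∧
      ∀ i, ZOmega.cn (a i) ≤ r.factorial * (4 ^ r * (2 ^ (t * (4 * t + 5))) ^ r) := by
  classical
  subst hr
  have hne : invSqrt2 ≠ 0 := invSqrt2_ne_zero
  -- a minimal decomposition, linearly independent
  obtain ⟨c, φ, hφ, hdec⟩ := exists_stabilizerDecomposition (tensorPow magicT t)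
  have hli : LinearIndependent ℂ φ := linearIndependent_of_card_eq_stabilizerRank c φ hφ hdec rfl
  -- gadget presentations of the states
  have hpres : ∀ i, ∃ (d : Fin t → ℕ × QReg t × QReg t) (z : QReg t) (s : ℂ), s ≠ 0 ∧
      ∀ ζ : ℂ, projZ t (prodZeta ζ (allGadgets d) *ᵥ basisState (Fin.append z (zlab t))) = s • φ i :=
    fun i => exists_gadget_presentation (hφ i)
  choose d z s hs hpres using hpres
  -- integral amplitude vectors
  have hint : ∀ i x, ∃ g : GaussianInt, (g : ℂ) = invSqrt2⁻¹ ^ hCount (allGadgets (d i)) *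
      (prodZeta omega (allGadgets (d i)) *ᵥ basisState (Fin.append (z i) (zlab t))) (Fin.append x (zlab t)) ∧
        g.re.natAbs ≤ 2 ^ hCount (allGadgets (d i)) ∧ g.im.natAbs ≤ 2 ^ hCount (allGadgets (d i)) :=
    fun i x => exists_gaussInt_amplitude (allGadgets (d i)) (allGadgets_isOracleFree (d i)) (allGadgets_isT (d i)) _ _
  choose g hg hgre hgim using hint
  set u : Fin (stabilizerRank (tensorPow magicT t)) → QReg t → ZOmega := fun i x => ofGauss (g i x) with hu
  set b : QReg t → ZOmega := fun x => omegaZ ^ ones x with hb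
  have hH : ∀ i, hCount (allGadgets (d i)) ≤ t * (4 * t + 5) := fun i =>
    (hCount_le_length _).trans (length_allGadgets_le (d i))
  -- the complex images
  have hval_u : ∀ i, (ZOmega.val ∘ u i : QReg t → ℂ) = (invSqrt2⁻¹ ^ hCount (allGadgets (d i)) * s i) • φ i := by
    intro i; funext x
    have hp := congrFun (hpres i omega) x
    rw [projZ_apply'] at hp
    simp only [Function.comp_apply, hu, val_ofGauss, hg, Pi.smul_apply, smul_eq_mul]
    rw [hp, Pi.smul_apply, smul_eq_mul]; ring
  have hval_b : (ZOmega.val ∘ b : QReg t → ℂ) = (invSqrt2⁻¹ ^ t) • tensorPow magicT t := by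
    funext x
    simp only [Function.comp_apply, hb, map_pow, val_omegaZ, Pi.smul_apply, smul_eq_mul, tensorPow_magicT_apply]
    rw [← mul_assoc, ← mul_pow, inv_mul_cancel₀ hne, one_pow, one_mul]
  have hcoef : ∀ i, invSqrt2⁻¹ ^ hCount (allGadgets (d i)) * s i ≠ 0 := fun i =>
    mul_ne_zero (pow_ne_zero _ (inv_ne_zero hne)) (hs i)
  -- independence and span
  have hli' : LinearIndependent ℂ fun i => (ZOmega.val ∘ u i : QReg t → ℂ) := by
    have h := hli.units_smul fun i => (isUnit_iff_ne_zero.2 (hcoef i)).unit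
    convert h using 1
    funext i
    rw [hval_u, Pi.smul_apply']
    rfl
  have hspan : (ZOmega.val ∘ b : QReg t → ℂ) ∈ Submodule.span ℂ (Set.range fun i => (ZOmega.val ∘ u i : QReg t → ℂ)) := by
    have e := congrArg (fun v : QReg t → ℂ => invSqrt2⁻¹ ^ t • v) hdec
    simp only [Finset.smul_sum] at e
    rw [hval_b, e]
    refine Submodule.sum_mem _ fun i _ => ?_
    have e : φ i = (invSqrt2⁻¹ ^ hCount (allGadgets (d i)) * s i)⁻¹ • (ZOmega.val ∘ u i : QReg t → ℂ) := by
      rw [hval_u, smul_smul, inv_mul_cancel₀ (hcoef i), one_smul]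
    rw [e, smul_smul, smul_smul]
    exact Submodule.smul_mem _ _ (Submodule.subset_span ⟨i, rfl⟩)
  obtain ⟨D, a, hD, hid, hbd⟩ := ZOmega.exists_cramer_combination u b hli' hspan
  have hcu : ∀ i x, ZOmega.cn (u i x) ≤ 2 ^ (t * (4 * t + 5)) := fun i x =>
    cn_ofGauss_le ((hgre i x).trans (Nat.pow_le_pow_right (by norm_num) (hH i)))
      ((hgim i x).trans (Nat.pow_le_pow_right (by norm_num) (hH i)))
  obtain ⟨hcD, hca⟩ := hbd (2 ^ (t * (4 * t + 5))) hcu (fun x => (cn_omegaZ_pow_le _).trans Nat.one_le_two_pow)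
  refine ⟨d, z, u, D, a, fun i x => ?_, hcu, hD, hid, hcD, hca⟩
  simp only [hu, val_ofGauss, hg]

end StabilizerFormalism

end Literature.Computability.QuantumComplexity

/-! ### The per-length data and the master identity -/

namespace Literature.Computability.QuantumComplexity

namespace SharpPHT

namespace Core

open _root_.Computability Cryptography Matrix Complex BravyiGosset StabilizerFormalism Complexity RevClean

variable (Q : Core)

/-! #### Chosen data at input length `n` -/

/-- The number of wires of the core circuit at input length `n`. [folklore] -/
abbrev NW (n : ℕ) : ℕ := n + Q.anc n

/-- The `T`-count of the core circuit at input length `n`. [folklore] -/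
def tN (n : ℕ) : ℕ := (Q.circ n).tCount

/-- The rank `r = χ(|T⟩^{⊗t})` at input length `n`. [folklore] -/
def rN (n : ℕ) : ℕ := stabilizerRank (tensorPow magicT (Q.tN n))

/-- The gadgetized Clifford gate list of the core circuit (a choice). [cite: BravyiEtAl2019, §2.3.1 eq. (16)] -/
def cList (n : ℕ) : List (QGate cliffordT (Q.NW n + Q.tN n)) :=
  Classical.choose (gadgetizeListLen 0 (Q.circ n).gates (Q.circ_isOracleFree n) (Q.tN n) rfl)

/-- Properties of the gadgetized list: oracle-free, `T`-free, same length, and the gadget identity.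
[cite: BravyiEtAl2019, §2.3.1 eq. (16)] -/
theorem cList_spec' (n : ℕ) :
    (∀ g ∈ Q.cList n, g.IsOracleFree) ∧ (⟨Q.cList n⟩ : QCircuit cliffordT (Q.NW n + Q.tN n)).tCount = 0 ∧
      (Q.cList n).length = (Q.circ n).gates.length ∧
      ∀ ψ : QReg (Q.NW n) → ℂ, (⟨(Q.circ n).gates⟩ : QCircuit cliffordT (Q.NW n)).toMatrix 0 *ᵥ ψ =
        (invSqrt2⁻¹ ^ Q.tN n) • projZ (Q.tN n)
          ((⟨Q.cList n⟩ : QCircuit cliffordT (Q.NW n + Q.tN n)).toMatrix 0 *ᵥ tensorVec ψ (tensorPow magicT (Q.tN n))) :=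
  Classical.choose_spec (gadgetizeListLen 0 (Q.circ n).gates (Q.circ_isOracleFree n) (Q.tN n) rfl)

/-- Properties of the gadgetized list: oracle-free, `T`-free, and the gadget identity. [cite: BravyiEtAl2019, §2.3.1 eq. (16)] -/
theorem cList_spec (n : ℕ) :
    (∀ g ∈ Q.cList n, g.IsOracleFree) ∧ (⟨Q.cList n⟩ : QCircuit cliffordT (Q.NW n + Q.tN n)).tCount = 0 ∧
      ∀ ψ : QReg (Q.NW n) → ℂ, (⟨(Q.circ n).gates⟩ : QCircuit cliffordT (Q.NW n)).toMatrix 0 *ᵥ ψ =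
        (invSqrt2⁻¹ ^ Q.tN n) • projZ (Q.tN n)
          ((⟨Q.cList n⟩ : QCircuit cliffordT (Q.NW n + Q.tN n)).toMatrix 0 *ᵥ tensorVec ψ (tensorPow magicT (Q.tN n))) :=
  ⟨(Q.cList_spec' n).1, (Q.cList_spec' n).2.1, (Q.cList_spec' n).2.2.2⟩

/-- The gates of a `T`-count-zero list are non-`T` gates. [folklore] -/
theorem isT_eq_false_of_tCount_eq_zero {W : ℕ} {L : List (QGate cliffordT W)}
    (h : (⟨L⟩ : QCircuit cliffordT W).tCount = 0) : ∀ g ∈ L, g.isT = false := by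
  intro g hg
  have := List.countP_eq_zero.1 h g hg
  simpa using this

/-- The decomposition data at input length `n`, bundled (existence). [cite: MehrabanTahmasbi2024, proof of Theorem 1.6 (arXiv p. 6)] -/
theorem exists_decompTuple (n : ℕ) :
    ∃ p : (Fin (Q.rN n) → Fin (Q.tN n) → ℕ × QReg (Q.tN n) × QReg (Q.tN n)) × (Fin (Q.rN n) → QReg (Q.tN n)) ×
      (Fin (Q.rN n) → QReg (Q.tN n) → ZOmega) × ZOmega × (Fin (Q.rN n) → ZOmega),
      (∀ i x, ZOmega.val (p.2.2.1 i x) = invSqrt2⁻¹ ^ hCount (allGadgets (p.1 i)) *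
        (prodZeta omega (allGadgets (p.1 i)) *ᵥ basisState (Fin.append (p.2.1 i) (zlab _))) (Fin.append x (zlab _))) ∧
      (∀ i x, ZOmega.cn (p.2.2.1 i x) ≤ 2 ^ (Q.tN n * (4 * Q.tN n + 5))) ∧
      ZOmega.val p.2.2.2.1 ≠ 0 ∧
      (∀ x, ∑ i, p.2.2.2.2 i * p.2.2.1 i x = p.2.2.2.1 * omegaZ ^ ones x) ∧
      ZOmega.cn p.2.2.2.1 ≤ (Q.rN n).factorial * (4 ^ Q.rN n * (2 ^ (Q.tN n * (4 * Q.tN n + 5))) ^ Q.rN n) ∧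
      ∀ i, ZOmega.cn (p.2.2.2.2 i) ≤ (Q.rN n).factorial * (4 ^ Q.rN n * (2 ^ (Q.tN n * (4 * Q.tN n + 5))) ^ Q.rN n) := by
  obtain ⟨d, z, u, D, a, h⟩ := exists_integral_decomposition (t := Q.tN n) (r := Q.rN n) rfl
  exact ⟨⟨d, z, u, D, a⟩, h⟩

/-- The integral decomposition data at input length `n` (a choice): gadget data, labels, integral
vectors, and Cramer's `D, aᵢ`. [cite: MehrabanTahmasbi2024, proof of Theorem 1.6 (arXiv p. 6)] -/
def decomp (n : ℕ) :
    (Fin (Q.rN n) → Fin (Q.tN n) → ℕ × QReg (Q.tN n) × QReg (Q.tN n)) × (Fin (Q.rN n) → QReg (Q.tN n)) ×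
      (Fin (Q.rN n) → QReg (Q.tN n) → ZOmega) × ZOmega × (Fin (Q.rN n) → ZOmega) :=
  Classical.choose (Q.exists_decompTuple n)

/-- The gadget data. [folklore] -/
def dD (n : ℕ) : Fin (Q.rN n) → Fin (Q.tN n) → ℕ × QReg (Q.tN n) × QReg (Q.tN n) := (Q.decomp n).1
/-- The gadget labels. [folklore] -/
def zD (n : ℕ) : Fin (Q.rN n) → QReg (Q.tN n) := (Q.decomp n).2.1
/-- The integral vectors. [folklore] -/
def uD (n : ℕ) : Fin (Q.rN n) → QReg (Q.tN n) → ZOmega := (Q.decomp n).2.2.1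
/-- Cramer's denominator `D`. [folklore] -/
def DD (n : ℕ) : ZOmega := (Q.decomp n).2.2.2.1
/-- Cramer's numerators `aᵢ`. [folklore] -/
def aD (n : ℕ) : Fin (Q.rN n) → ZOmega := (Q.decomp n).2.2.2.2

/-- The specification of the decomposition data. [cite: MehrabanTahmasbi2024, proof of Theorem 1.6 (arXiv p. 6)] -/
theorem decomp_spec (n : ℕ) :
    (∀ i x, ZOmega.val (Q.uD n i x) = invSqrt2⁻¹ ^ hCount (allGadgets (Q.dD n i)) *
        (prodZeta omega (allGadgets (Q.dD n i)) *ᵥ basisState (Fin.append (Q.zD n i) (zlab _))) (Fin.append x (zlab _))) ∧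
      (∀ i x, ZOmega.cn (Q.uD n i x) ≤ 2 ^ (Q.tN n * (4 * Q.tN n + 5))) ∧
      ZOmega.val (Q.DD n) ≠ 0 ∧
      (∀ x, ∑ i, Q.aD n i * Q.uD n i x = Q.DD n * omegaZ ^ ones x) ∧
      ZOmega.cn (Q.DD n) ≤ (Q.rN n).factorial * (4 ^ Q.rN n * (2 ^ (Q.tN n * (4 * Q.tN n + 5))) ^ Q.rN n) ∧
      ∀ i, ZOmega.cn (Q.aD n i) ≤ (Q.rN n).factorial * (4 ^ Q.rN n * (2 ^ (Q.tN n * (4 * Q.tN n + 5))) ^ Q.rN n) :=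
  Classical.choose_spec (Q.exists_decompTuple n)

/-- **The merged gate list of term `i`**: the gadget word of `φᵢ` on the gadget register, then the
gadgetized circuit on the circuit register. [cite: MehrabanTahmasbi2024, proof of Theorem 1.6] -/
def mList (n : ℕ) (i : Fin (Q.rN n)) : List (QGate cliffordT (Q.NW n + Q.tN n + Q.tN n)) :=
  (allGadgets (Q.dD n i)).map (mapWiresGate (magicEmb (Q.NW n) (Q.tN n))) ++
    (Q.cList n).map (mapWiresGate (Fin.castAddEmb (Q.tN n)))

/-- The merged list is oracle-free. [folklore] -/
theorem mList_isOracleFree (n : ℕ) (i : Fin (Q.rN n)) : ∀ g ∈ Q.mList n i, g.IsOracleFree := by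
  intro g hg
  rcases List.mem_append.1 hg with hg | hg
  · exact isOracleFree_map_mapWiresGate _ (allGadgets_isOracleFree _) g hg
  · exact isOracleFree_map_mapWiresGate _ (Q.cList_spec n).1 g hg

/-- The merged list is `T`-free. [folklore] -/
theorem mList_isT (n : ℕ) (i : Fin (Q.rN n)) : ∀ g ∈ Q.mList n i, g.isT = false := by
  intro g hg
  rcases List.mem_append.1 hg with hg | hg
  · obtain ⟨g', hg', rfl⟩ := List.mem_map.1 hg
    rw [isT_mapWiresGate]; exact allGadgets_isT _ g' hg'
  · obtain ⟨g', hg', rfl⟩ := List.mem_map.1 hg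
    rw [isT_mapWiresGate]; exact isT_eq_false_of_tCount_eq_zero (Q.cList_spec n).2.1 g' hg'

/-- The Hadamard count of a concatenation. [folklore] -/
theorem hCount_append' {W : ℕ} (L L' : List (QGate cliffordT W)) : hCount (L ++ L') = hCount L + hCount L' := by
  simp [hCount, List.countP_append]

/-- Transport preserves being an `H` gate. [folklore] -/
theorem qGateIsH_mapWiresGate {W W' : ℕ} (ι : Fin W ↪ Fin W') (g : QGate cliffordT W) :
    QGateIsH (mapWiresGate ι g) = QGateIsH g := by
  cases g with
  | gate g e => cases g <;> rfl
  | oracle k e => rfl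

/-- Transport preserves the Hadamard count. [folklore] -/
theorem hCount_map_mapWiresGate {W W' : ℕ} (ι : Fin W ↪ Fin W') (L : List (QGate cliffordT W)) :
    hCount (L.map (mapWiresGate ι)) = hCount L := by
  induction L with
  | nil => rfl
  | cons g L ih => rw [List.map_cons, hCount_cons, hCount_cons, ih, qGateIsH_mapWiresGate]

/-- The Hadamard count of the merged list. [folklore] -/
theorem hCount_mList (n : ℕ) (i : Fin (Q.rN n)) :
    hCount (Q.mList n i) = hCount (allGadgets (Q.dD n i)) + hCount (Q.cList n) := by
  rw [mList, hCount_append', hCount_map_mapWiresGate, hCount_map_mapWiresGate]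

/-! #### The master identity -/

section Master

variable (y : List Bool)

/-- The initial label: `y 0^{anc}`. [folklore] -/
def initLab : QReg (Q.NW y.length) := padInput y.get (Q.anc y.length)

/-- **The exact value of term `i`**: the coded Gauss sum of the merged list between the initial label
`(y 0^{anc}, zᵢ, 0^t)` and the final label `(yfin, 0^t, 0^t)`. [cite: MehrabanTahmasbi2024, proof of Theorem 1.6] -/
def termVal (i : Fin (Q.rN y.length)) : GaussianInt :=
  ampValOf ((Q.mList y.length i).map gateTriple,
    (List.ofFn (lab3 (Q.initLab y) (Q.zD y.length i) (fun _ => false)),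
      List.ofFn (lab3 (yfin (Q := Q) y) (fun _ : Fin (Q.tN y.length) => false) (fun _ : Fin (Q.tN y.length) => false))))

/-- **The weighted sum `S = Σᵢ aᵢ Eᵢ ∈ ℤ[ω]`.** [cite: MehrabanTahmasbi2024, proof of Theorem 1.6] -/
def sumS : ZOmega := ∑ i, Q.aD y.length i * ofGauss (Q.termVal y i)

/-- `|S₂| = ρ + A₁`. [folklore] -/
theorem card_S2 (n : ℕ) : (S2 Q n).card = Q.rho n + A₁ Q.M := by
  rw [S2, List.toFinset_card_of_nodup (Q.h2Wires_nodup n), h2Wires, List.length_append]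
  simp [coinWires, resWires, resLen]

/-- The amplitude of term `i` on the master register, in closed form. [folklore] -/
theorem termVal_spec (i : Fin (Q.rN y.length)) :
    ∑ v : QReg (Q.tN y.length),
        prodZeta omega (Q.cList y.length) (Fin.append (yfin (Q := Q) y) fun _ => false) (Fin.append (Q.initLab y) v) *
          (prodZeta omega (allGadgets (Q.dD y.length i)) *ᵥ basisState (Fin.append (Q.zD y.length i) fun _ => false))
            (Fin.append v fun _ => false) =
      invSqrt2 ^ (hCount (allGadgets (Q.dD y.length i)) + hCount (Q.cList y.length)) *
        (1 / 2 : ℂ) ^ (Q.NW y.length + Q.tN y.length + Q.tN y.length) * (Q.termVal y i : ℂ) := by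
  rw [← merge_amplitude _ (allGadgets_isOracleFree _) _ (Q.cList_spec y.length).1,
    show (allGadgets (Q.dD y.length i)).map (mapWiresGate (magicEmb (Q.NW y.length) (Q.tN y.length))) ++
      (Q.cList y.length).map (mapWiresGate (Fin.castAddEmb (Q.tN y.length))) = Q.mList y.length i from rfl,
    ampValOf_spec (Q.mList y.length i) (Q.mList_isOracleFree y.length i) (Q.mList_isT y.length i), hCount_mList, termVal]

/-- **The master identity (complex form).**
`gap · val D · (1/√2)^{2ρ + A₁} = (1/√2)^{h_C} (1/2)^W · val S`, `gap = 2^ρ - 2 #witnesses`.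
[cite: MehrabanTahmasbi2024, proof of Theorem 1.6 (arXiv p. 5–6)] -/
theorem master_complex :
    ((((2 : ℤ) ^ Q.rho y.length - 2 * countWitnesses Q.R (Q.rho y.length) y : ℤ) : ℂ)) *
        ZOmega.val (Q.DD y.length) * invSqrt2 ^ (Q.rho y.length + (Q.rho y.length + A₁ Q.M)) =
      invSqrt2 ^ hCount (Q.cList y.length) * (1 / 2 : ℂ) ^ (Q.NW y.length + Q.tN y.length + Q.tN y.length) *
        ZOmega.val (Q.sumS y) := by
  obtain ⟨hof, hT, hgad⟩ := Q.cList_spec y.length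
  obtain ⟨hu, -, hD, hid, -, -⟩ := Q.decomp_spec y.length
  have hne : invSqrt2 ≠ 0 := invSqrt2_ne_zero
  have hone : invSqrt2⁻¹ ^ Q.tN y.length * invSqrt2 ^ Q.tN y.length = 1 := by
    rw [← mul_pow, inv_mul_cancel₀ hne, one_pow]
  -- (a) the Hadamard-test amplitude
  have ha : (Q.circ y.length).runOn 0 (basisState (Q.initLab y)) (yfin (Q := Q) y) =
      invSqrt2 ^ Q.rho y.length * invSqrt2 ^ (S2 Q y.length).card *
        ((((2 : ℤ) ^ Q.rho y.length - 2 * countWitnesses Q.R (Q.rho y.length) y : ℤ) : ℂ)) :=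
    runOn_circ_yfin (Q := Q) y
  rw [card_S2] at ha
  -- abbreviations
  set P : QReg (Q.tN y.length) → ℂ := fun v =>
    prodZeta omega (Q.cList y.length) (Fin.append (yfin (Q := Q) y) fun _ => false) (Fin.append (Q.initLab y) v) with hP
  set Gam : Fin (Q.rN y.length) → QReg (Q.tN y.length) → ℂ := fun i v =>
    (prodZeta omega (allGadgets (Q.dD y.length i)) *ᵥ basisState (Fin.append (Q.zD y.length i) (zlab _)))
      (Fin.append v (zlab _)) with hGam
  -- (b) gadgetized
  have hb : (Q.circ y.length).runOn 0 (basisState (Q.initLab y)) (yfin (Q := Q) y) =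
      invSqrt2⁻¹ ^ Q.tN y.length * ∑ v : QReg (Q.tN y.length), P v * tensorPow magicT (Q.tN y.length) v := by
    rw [QCircuit.runOn, show (Q.circ y.length).toMatrix 0 = (⟨(Q.circ y.length).gates⟩ : QCircuit cliffordT _).toMatrix 0 from rfl,
      hgad, Pi.smul_apply, smul_eq_mul, projZ_apply', mulVec_tensorVec_basisState_apply,
      ← prodZeta_omega 0 (show (⟨Q.cList y.length⟩ : QCircuit cliffordT _).IsOracleFree from hof)]
  -- (c) insert the decomposition: `val D · T^t(v) = (1/√2)^t Σ aᵢ uᵢ(v)`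
  have hc : ∀ v : QReg (Q.tN y.length), ZOmega.val (Q.DD y.length) * tensorPow magicT (Q.tN y.length) v =
      invSqrt2 ^ Q.tN y.length * ∑ i, ZOmega.val (Q.aD y.length i) * ZOmega.val (Q.uD y.length i v) := by
    intro v
    rw [tensorPow_magicT_apply, ← val_omegaZ, ← map_pow, mul_left_comm, ← map_mul, ← hid v, map_sum]
    simp only [map_mul]
  -- (d) term by term
  have hterm : ∀ i, ∑ v : QReg (Q.tN y.length), P v * (ZOmega.val (Q.aD y.length i) * ZOmega.val (Q.uD y.length i v)) =
      ZOmega.val (Q.aD y.length i) * (invSqrt2 ^ hCount (Q.cList y.length) *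
        (1 / 2 : ℂ) ^ (Q.NW y.length + Q.tN y.length + Q.tN y.length) * (Q.termVal y i : ℂ)) := by
    intro i
    have e := Q.termVal_spec y i
    have e1 : ∑ v : QReg (Q.tN y.length), P v * (ZOmega.val (Q.aD y.length i) * ZOmega.val (Q.uD y.length i v)) =
        ZOmega.val (Q.aD y.length i) * invSqrt2⁻¹ ^ hCount (allGadgets (Q.dD y.length i)) *
          ∑ v : QReg (Q.tN y.length), P v * Gam i v := by
      rw [Finset.mul_sum]
      refine Finset.sum_congr rfl fun v _ => ?_
      rw [hu i v]
      ring
    rw [e1]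
    change ZOmega.val (Q.aD y.length i) * invSqrt2⁻¹ ^ hCount (allGadgets (Q.dD y.length i)) *
      (∑ v : QReg (Q.tN y.length), P v * Gam i v) = _
    rw [show (∑ v : QReg (Q.tN y.length), P v * Gam i v) = _ from e, pow_add]
    have h1 : invSqrt2⁻¹ ^ hCount (allGadgets (Q.dD y.length i)) * invSqrt2 ^ hCount (allGadgets (Q.dD y.length i)) = 1 := by
      rw [← mul_pow, inv_mul_cancel₀ hne, one_pow]
    linear_combination (ZOmega.val (Q.aD y.length i) * (invSqrt2 ^ hCount (Q.cList y.length) *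
      (1 / 2 : ℂ) ^ (Q.NW y.length + Q.tN y.length + Q.tN y.length) * (Q.termVal y i : ℂ))) * h1
  -- assemble
  have key : ZOmega.val (Q.DD y.length) * (Q.circ y.length).runOn 0 (basisState (Q.initLab y)) (yfin (Q := Q) y) =
      invSqrt2 ^ hCount (Q.cList y.length) * (1 / 2 : ℂ) ^ (Q.NW y.length + Q.tN y.length + Q.tN y.length) *
        ZOmega.val (Q.sumS y) := by
    calc ZOmega.val (Q.DD y.length) * (Q.circ y.length).runOn 0 (basisState (Q.initLab y)) (yfin (Q := Q) y)
        = ∑ v : QReg (Q.tN y.length), invSqrt2⁻¹ ^ Q.tN y.length *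
            (P v * (ZOmega.val (Q.DD y.length) * tensorPow magicT (Q.tN y.length) v)) := by
          rw [hb, mul_left_comm, Finset.mul_sum, Finset.mul_sum]
          exact Finset.sum_congr rfl fun v _ => by ring
      _ = ∑ v : QReg (Q.tN y.length), ∑ i, P v * (ZOmega.val (Q.aD y.length i) * ZOmega.val (Q.uD y.length i v)) := by
          refine Finset.sum_congr rfl fun v _ => ?_
          rw [hc v, Finset.mul_sum, Finset.mul_sum, Finset.mul_sum]
          refine Finset.sum_congr rfl fun i _ => ?_
          linear_combination (P v * (ZOmega.val (Q.aD y.length i) * ZOmega.val (Q.uD y.length i v))) * hone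
      _ = ∑ i, ∑ v : QReg (Q.tN y.length), P v * (ZOmega.val (Q.aD y.length i) * ZOmega.val (Q.uD y.length i v)) :=
          Finset.sum_comm
      _ = ∑ i, ZOmega.val (Q.aD y.length i) * (invSqrt2 ^ hCount (Q.cList y.length) *
            (1 / 2 : ℂ) ^ (Q.NW y.length + Q.tN y.length + Q.tN y.length) * (Q.termVal y i : ℂ)) :=
          Finset.sum_congr rfl fun i _ => hterm i
      _ = _ := by
          rw [sumS, map_sum, Finset.mul_sum]
          refine Finset.sum_congr rfl fun i _ => ?_
          rw [map_mul, val_ofGauss]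
          ring
  have hfinal := key
  rw [ha] at hfinal
  rw [← hfinal]
  ring

end Master

end Core

end SharpPHT

end Literature.Computability.QuantumComplexity

/-! ### From the master identity to the exact witness count -/

namespace Literature.Computability.QuantumComplexity

namespace SharpPHT

namespace Core

open _root_.Computability Cryptography Matrix Complex BravyiGosset StabilizerFormalism Complexity RevClean
  Literature.Computability.Complexity.CodeFP

variable (Q : Core)

/-- The denominator `den = D · 2^W · √2^{h_C} ∈ ℤ[ω]` at input length `n`. [folklore] -/
def den (n : ℕ) : ZOmega := Q.DD n * 2 ^ (Q.NW n + Q.tN n + Q.tN n) * sq2Z ^ hCount (Q.cList n)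

/-- The multiplier `mult = 2^ρ · √2^{A₁} ∈ ℤ[ω]` at input length `n`. [folklore] -/
def mult (n : ℕ) : ZOmega := 2 ^ Q.rho n * sq2Z ^ A₁ Q.M

/-- The gap `2^ρ - 2 · #witnesses`. [cite: AroraBarak2009, §17.2.1] -/
def gap (y : List Bool) : ℤ := (2 : ℤ) ^ Q.rho y.length - 2 * countWitnesses Q.R (Q.rho y.length) y

/-- `val √2 ≠ 0`. [folklore] -/
theorem val_sq2Z_ne_zero : ZOmega.val sq2Z ≠ 0 := by rw [val_sq2Z]; exact inv_ne_zero invSqrt2_ne_zero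

/-- **The master identity in `ℤ[ω]`**: `gap · den = S · mult`. [cite: MehrabanTahmasbi2024, proof of Theorem 1.6 (arXiv p. 5–6)] -/
theorem master_zomega (y : List Bool) : (Q.gap y : ZOmega) * Q.den y.length = Q.sumS y * Q.mult y.length := by
  apply ZOmega.val_injective
  have M := Q.master_complex y
  have hx : (invSqrt2 : ℂ) ≠ 0 := invSqrt2_ne_zero
  set x : ℂ := invSqrt2 with hxdef
  set v : ℂ := ZOmega.val sq2Z with hvdef
  have hvx : v * x = 1 := by rw [hvdef, val_sq2Z, inv_mul_cancel₀ hx]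
  have e1 : v ^ hCount (Q.cList y.length) * x ^ hCount (Q.cList y.length) = 1 := by rw [← mul_pow, hvx, one_pow]
  have e2 : v ^ A₁ Q.M * x ^ A₁ Q.M = 1 := by rw [← mul_pow, hvx, one_pow]
  have e3 : (2 : ℂ) ^ Q.rho y.length * x ^ Q.rho y.length * x ^ Q.rho y.length = 1 := by
    rw [← mul_pow, ← mul_pow, mul_assoc, hxdef, invSqrt2_mul_invSqrt2]; norm_num
  have e4 : (1 / 2 : ℂ) ^ (Q.NW y.length + Q.tN y.length + Q.tN y.length) * 2 ^ (Q.NW y.length + Q.tN y.length + Q.tN y.length) = 1 := by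
    rw [← mul_pow]; norm_num
  simp only [den, mult, gap, map_mul, map_pow, map_intCast, map_ofNat]
  rw [← hvdef]
  rw [pow_add] at M
  set g : ℂ := (((2 : ℤ) ^ Q.rho y.length - 2 * countWitnesses Q.R (Q.rho y.length) y : ℤ) : ℂ) with hg
  set vD := ZOmega.val (Q.DD y.length)
  set vS := ZOmega.val (Q.sumS y)
  set W := Q.NW y.length + Q.tN y.length + Q.tN y.length
  set hC := hCount (Q.cList y.length)
  set ρ := Q.rho y.length
  set A := A₁ Q.M
  -- `M : g * vD * (x^ρ * (x^ρ * x^A)) = x^hC * (1/2)^W * vS`; goal: `g * (vD * 2^W * v^hC) = vS * (2^ρ * v^A)`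
  linear_combination ((2 : ℂ) ^ W * v ^ hC * 2 ^ ρ * v ^ A) * M
    - (g * vD * 2 ^ W * v ^ hC * (v ^ A * x ^ A)) * e3 - (g * vD * 2 ^ W * v ^ hC) * e2
    + (vS * 2 ^ ρ * v ^ A * (v ^ hC * x ^ hC)) * e4 + (vS * 2 ^ ρ * v ^ A) * e1

/-- The co-denominator `conj5 den · starP (den · conj5 den)`. [folklore] -/
def coden (n : ℕ) : ZOmega := ZOmega.conj5 (Q.den n) * ZOmega.starP (Q.den n * ZOmega.conj5 (Q.den n))

/-- The integer norm of the denominator. [folklore] -/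
def nrm (n : ℕ) : ℤ := ZOmega.inorm (Q.den n)

/-- The denominator is non-zero. [folklore] -/
theorem den_ne_zero (n : ℕ) : Q.den n ≠ 0 := by
  intro h
  have hv := congrArg ZOmega.val h
  rw [den, map_mul, map_mul, map_pow, map_pow, map_zero, map_ofNat] at hv
  exact (mul_ne_zero (mul_ne_zero (Q.decomp_spec n).2.2.1 (pow_ne_zero _ two_ne_zero)) (pow_ne_zero _ val_sq2Z_ne_zero)) hv

/-- The norm is non-zero. [folklore] -/
theorem nrm_ne_zero (n : ℕ) : Q.nrm n ≠ 0 := ZOmega.inorm_ne_zero (Q.den_ne_zero n)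

/-- **The gap as an exact integer quotient**: `gap = ((S · mult · coden).p.re) / nrm`.
[cite: MehrabanTahmasbi2024, proof of Theorem 1.6] -/
theorem gap_eq_div (y : List Bool) :
    Q.gap y = (Q.sumS y * Q.mult y.length * Q.coden y.length).p.re / Q.nrm y.length := by
  have h := ZOmega.intCast_mul_eq_coord (num := Q.sumS y * Q.mult y.length) (D := Q.den y.length) (k := Q.gap y)
    (Q.master_zomega y).symm
  rw [mul_assoc (Q.sumS y * Q.mult y.length)] at h
  rw [coden, nrm, h]
  exact (Int.mul_ediv_cancel _ (Q.nrm_ne_zero y.length)).symm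

/-- **The witness count from the gap.** [cite: AroraBarak2009, §17.2.1] -/
theorem count_eq (y : List Bool) : (countWitnesses Q.R (Q.rho y.length) y : ℤ) = ((2 : ℤ) ^ Q.rho y.length - Q.gap y) / 2 := by
  rw [gap]; omega

/-! ### The labels as bit lists -/

/-- The initial label as a list: `y 0^{anc} zᵢ 0^t`. [folklore] -/
theorem ofFn_initLab3 (y : List Bool) (i : Fin (Q.rN y.length)) :
    List.ofFn (lab3 (Q.initLab y) (Q.zD y.length i) (fun _ => false)) =
      y ++ List.replicate (Q.anc y.length) false ++ (List.ofFn (Q.zD y.length i) ++ List.replicate (Q.tN y.length) false) := by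
  rw [lab3, List.ofFn_fin_append, List.ofFn_fin_append, List.ofFn_const, initLab, padInput, List.ofFn_fin_append,
    List.ofFn_get, List.ofFn_const, List.append_assoc]

/-- **The `y`-independent tail of the final label**: pattern bit on `S₂`, the constant read-out
elsewhere. [folklore] -/
def tailFn (n : ℕ) (j : Fin (Q.anc n)) : Bool :=
  if Fin.natAdd n j ∈ S2 Q n then decide (Fin.natAdd n j = tWire Q n)
  else readOut Q.e Q.M (Q.nT n) [false] (Fin.natAdd n j : Fin (n + Q.anc n))

/-- The tail as a list. [folklore] -/
def base (n : ℕ) : List Bool := List.ofFn (Q.tailFn n)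

/-- Input wires are not in `S₂`. [folklore] -/
theorem castAdd_not_mem_S2 (y : List Bool) (j : Fin y.length) : Fin.castAdd (Q.anc y.length) j ∉ S2 Q y.length := by
  rw [mem_S2_iff, not_or]
  have h1 := Q.nT_le_resStart y.length
  unfold nT n0 at h1
  simp only [Fin.val_castAdd]
  constructor <;> omega

/-- **The final label is `y` followed by the `y`-independent tail.** [folklore] -/
theorem yfin_eq_append (y : List Bool) : yfin (Q := Q) y = Fin.append y.get (Q.tailFn y.length) := by
  funext q
  induction q using Fin.addCases with
  | left j =>
    rw [Fin.append_left, yfin, if_neg (Q.castAdd_not_mem_S2 y j),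
      sigma_apply_of_lt y _ (by simp only [Fin.val_castAdd]; unfold n0; omega)]
    simp only [Fin.val_castAdd]
    rw [List.getD_append _ _ _ _ j.2, List.getD_eq_getElem _ _ j.2]
    rfl
  | right j =>
    rw [Fin.append_right, yfin, tailFn]
    by_cases hq : Fin.natAdd y.length j ∈ S2 Q y.length
    · rw [if_pos hq, if_pos hq]
    · rw [if_neg hq, if_neg hq]
      have hq' := hq
      rw [mem_S2_iff, not_or] at hq'
      have hq1 := hq'.1
      rw [Fin.val_natAdd] at hq1
      have hge : ¬ ((Fin.natAdd y.length j : Fin (y.length + Q.anc y.length)) : ℕ) < Q.n0 y.length := by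
        rw [Fin.val_natAdd]; unfold n0; omega
      rw [sigma_apply, if_neg hge, outWord_eq]
      exact readOut_eq_of_not_mem y rfl rfl hq'.2

/-- The final label as a list: `y base 0^t 0^t`. [folklore] -/
theorem ofFn_finLab3 (y : List Bool) :
    List.ofFn (lab3 (yfin (Q := Q) y) (fun _ : Fin (Q.tN y.length) => false) (fun _ : Fin (Q.tN y.length) => false)) =
      y ++ Q.base y.length ++ (List.replicate (Q.tN y.length) false ++ List.replicate (Q.tN y.length) false) := by
  rw [lab3, List.ofFn_fin_append, List.ofFn_fin_append, List.ofFn_const, yfin_eq_append, List.ofFn_fin_append,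
    List.ofFn_get, base, List.append_assoc]

/-! ### The advice datum of a length and its evaluation -/

/-- **Advice datum**: what the polynomial-time machine reads for one query length — the number of
padding zeros, the tail of the final label, the common label tail, the items `(gate codes, label
tail, aᵢ)` of the decomposition terms, and the constants `mult, coden, nrm, ρ` of the closed formula.
[cite: MehrabanTahmasbi2024, proof of Theorem 1.6 (the polynomial advice)] -/
structure AdvDatum where
  /-- zeros after `y` in the initial label -/
  tail0 : ℕ
  /-- tail of the final label after `y` -/
  base : List Bool
  /-- common tail `0^{2t}` of the final label -/
  finTail : List Bool
  /-- items: merged gate codes, initial-label tail `zᵢ 0^t`, coefficient `aᵢ` -/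
  items : List (List GateCode × (List Bool × ZOmega))
  /-- the multiplier `2^ρ √2^{A₁}` -/
  mult : ZOmega
  /-- the co-denominator -/
  coden : ZOmega
  /-- the norm of the denominator -/
  nrm : ℤ
  /-- `ρ = p(n)` -/
  rho : ℕ

namespace AdvDatum

/-- The amplitude task of an item at query `y`. [folklore] -/
def taskOf (a : AdvDatum) (y : List Bool) (it : List GateCode × (List Bool × ZOmega)) : AT :=
  (it.1, (y ++ List.replicate a.tail0 false ++ it.2.1, y ++ a.base ++ a.finTail))

/-- **The closed formula**: from the exact term values `Eᵢ`, the witness count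
`(2^ρ - ((Σᵢ aᵢ Eᵢ) · mult · coden).p.re / nrm) / 2`. [cite: MehrabanTahmasbi2024, proof of Theorem 1.6] -/
def countOf (a : AdvDatum) (E : List GaussianInt) : ℤ :=
  ((2 : ℤ) ^ a.rho - ((List.zipWith (fun it e => it.2.2 * ofGauss e) a.items E).sum * a.mult * a.coden).p.re / a.nrm) / 2

/-- **Evaluation at a query**: run the amplitude evaluator on every item and apply the closed formula.
[cite: MehrabanTahmasbi2024, proof of Theorem 1.6] -/
def eval (a : AdvDatum) (y : List Bool) : ℤ := a.countOf (a.items.map fun it => ampValOf (a.taskOf y it))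

end AdvDatum

/-- **The advice datum of input length `n`.** [cite: MehrabanTahmasbi2024, proof of Theorem 1.6] -/
def advOf (n : ℕ) : AdvDatum where
  tail0 := Q.anc n
  base := Q.base n
  finTail := List.replicate (Q.tN n) false ++ List.replicate (Q.tN n) false
  items := List.ofFn fun i : Fin (Q.rN n) =>
    ((Q.mList n i).map gateTriple, (List.ofFn (Q.zD n i) ++ List.replicate (Q.tN n) false, Q.aD n i))
  mult := Q.mult n
  coden := Q.coden n
  nrm := Q.nrm n
  rho := Q.rho n

/-- `zipWith` of a map against an `ofFn`. [folklore] -/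
theorem zipWith_map_ofFn {α β γ δ : Type*} {k : ℕ} (f : α → γ → δ) (g : α → β) (h : β → γ) (u : Fin k → α) :
    List.zipWith f (List.ofFn u) ((List.ofFn u).map fun a => h (g a)) = List.ofFn fun i => f (u i) (h (g (u i))) := by
  apply List.ext_getElem
  · simp
  · intro j h1 h2; simp

/-- **The advice datum evaluates to the witness count.** [cite: MehrabanTahmasbi2024, proof of Theorem 1.6] -/
theorem eval_advOf (y : List Bool) : (Q.advOf y.length).eval y = countWitnesses Q.R (Q.rho y.length) y := by
  rw [Q.count_eq y, Q.gap_eq_div y, AdvDatum.eval, AdvDatum.countOf]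
  have hitems : (List.zipWith (fun it e => it.2.2 * ofGauss e) (Q.advOf y.length).items
      ((Q.advOf y.length).items.map fun it => ampValOf ((Q.advOf y.length).taskOf y it))).sum = Q.sumS y := by
    unfold advOf
    simp only
    rw [zipWith_map_ofFn, List.sum_ofFn, sumS]
    refine Finset.sum_congr rfl fun i _ => ?_
    simp only
    congr 2
    rw [termVal, AdvDatum.taskOf, ofFn_initLab3, ofFn_finLab3]
  rw [hitems]
  rfl

end Core

end SharpPHT

end Literature.Computability.QuantumComplexity

/-! ### Codes of advice data and their size -/

namespace Literature.Computability.QuantumComplexity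

namespace SharpPHT

open _root_.Computability Cryptography Matrix Complex BravyiGosset StabilizerFormalism Complexity RevClean
  Literature.Computability.Complexity.CodeFP

/-! #### Coordinate bounds in `ℤ[ω]` -/

/-- Powers: `cn (x^k) ≤ 4^k (cn x)^k`. [folklore] -/
theorem cn_pow_le (x : ZOmega) : ∀ k : ℕ, ZOmega.cn (x ^ k) ≤ 4 ^ k * ZOmega.cn x ^ k
  | 0 => by simp
  | k + 1 => by
    rw [pow_succ, pow_succ, pow_succ]
    calc ZOmega.cn (x ^ k * x) ≤ 4 * (ZOmega.cn (x ^ k) * ZOmega.cn x) := ZOmega.cn_mul_le _ _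
      _ ≤ 4 * (4 ^ k * ZOmega.cn x ^ k * ZOmega.cn x) := Nat.mul_le_mul_left _ (Nat.mul_le_mul_right _ (cn_pow_le x k))
      _ = 4 ^ k * 4 * (ZOmega.cn x ^ k * ZOmega.cn x) := by ring

/-- Natural numbers: `cn m = m`. [folklore] -/
theorem cn_natCast (m : ℕ) : ZOmega.cn (m : ZOmega) = m := by
  have h := ZOmega.intCast_eq (m : ℤ)
  rw [Int.cast_natCast] at h
  rw [h]; simp [ZOmega.cn]

/-- `cn (conj5 x) = cn x`. [folklore] -/
theorem cn_conj5 (x : ZOmega) : ZOmega.cn (ZOmega.conj5 x) = ZOmega.cn x := by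
  simp [ZOmega.cn, ZOmega.conj5]

/-- `cn (starP x) ≤ cn x`. [folklore] -/
theorem cn_starP_le (x : ZOmega) : ZOmega.cn (ZOmega.starP x) ≤ ZOmega.cn x := by
  simp only [ZOmega.cn, ZOmega.starP, Zsqrtd.re_star, Zsqrtd.im_star, Int.natAbs_neg, Zsqrtd.re_zero, Zsqrtd.im_zero,
    Int.natAbs_zero]
  omega

/-- `cn √2 = 1`. [folklore] -/
theorem cn_sq2Z : ZOmega.cn sq2Z = 1 := by
  have h2 : omegaZ ^ 2 = ⟨ZOmega.gi, 0⟩ := by ext <;> simp [pow_succ, omegaZ, ZOmega.gi]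
  rw [sq2Z, show (3 : ℕ) = 2 + 1 by rfl, pow_add, h2, pow_one]
  simp [ZOmega.cn, omegaZ, ZOmega.gi]

/-- The integer norm is at most `32 (cn x)^4` in absolute value. [folklore] -/
theorem natAbs_inorm_le (x : ZOmega) : (ZOmega.inorm x).natAbs ≤ 32 * ZOmega.cn x ^ 4 := by
  have ha := ZOmega.pre_le_cn x
  have hb := ZOmega.pim_le_cn x
  have hc := ZOmega.qre_le_cn x
  have hd := ZOmega.qim_le_cn x
  set c := ZOmega.cn x
  -- work in `ℤ`
  have e : ZOmega.inorm x = (x.p.re * x.p.re - x.p.im * x.p.im + 2 * (x.q.re * x.q.im)) ^ 2 +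
      (2 * (x.p.re * x.p.im) - (x.q.re * x.q.re - x.q.im * x.q.im)) ^ 2 := by
    simp [ZOmega.inorm, Zsqrtd.norm_def, Zsqrtd.re_mul, Zsqrtd.im_mul, Zsqrtd.re_sub, Zsqrtd.im_sub, ZOmega.gi]; ring
  have h1 : |x.p.re| ≤ (c : ℤ) := by rw [← Int.natCast_natAbs]; exact_mod_cast ha
  have h2 : |x.p.im| ≤ (c : ℤ) := by rw [← Int.natCast_natAbs]; exact_mod_cast hb
  have h3 : |x.q.re| ≤ (c : ℤ) := by rw [← Int.natCast_natAbs]; exact_mod_cast hc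
  have h4 : |x.q.im| ≤ (c : ℤ) := by rw [← Int.natCast_natAbs]; exact_mod_cast hd
  have k1 : |x.p.re * x.p.re| ≤ (c : ℤ) * c := by rw [abs_mul]; exact mul_le_mul h1 h1 (abs_nonneg _) (by positivity)
  have k2 : |x.p.im * x.p.im| ≤ (c : ℤ) * c := by rw [abs_mul]; exact mul_le_mul h2 h2 (abs_nonneg _) (by positivity)
  have k3 : |x.q.re * x.q.im| ≤ (c : ℤ) * c := by rw [abs_mul]; exact mul_le_mul h3 h4 (abs_nonneg _) (by positivity)
  have k4 : |x.p.re * x.p.im| ≤ (c : ℤ) * c := by rw [abs_mul]; exact mul_le_mul h1 h2 (abs_nonneg _) (by positivity)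
  have k5 : |x.q.re * x.q.re| ≤ (c : ℤ) * c := by rw [abs_mul]; exact mul_le_mul h3 h3 (abs_nonneg _) (by positivity)
  have k6 : |x.q.im * x.q.im| ≤ (c : ℤ) * c := by rw [abs_mul]; exact mul_le_mul h4 h4 (abs_nonneg _) (by positivity)
  have hA : |x.p.re * x.p.re - x.p.im * x.p.im + 2 * (x.q.re * x.q.im)| ≤ 4 * ((c : ℤ) * c) := by
    have := abs_sub (x.p.re * x.p.re) (x.p.im * x.p.im)
    have := abs_add_le (x.p.re * x.p.re - x.p.im * x.p.im) (2 * (x.q.re * x.q.im))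
    rw [abs_mul, abs_two] at this; linarith
  have hB : |2 * (x.p.re * x.p.im) - (x.q.re * x.q.re - x.q.im * x.q.im)| ≤ 4 * ((c : ℤ) * c) := by
    have := abs_sub (x.q.re * x.q.re) (x.q.im * x.q.im)
    have := abs_sub (2 * (x.p.re * x.p.im)) (x.q.re * x.q.re - x.q.im * x.q.im)
    rw [abs_mul, abs_two] at this; linarith
  have hsqA := sq_le_sq' (abs_le.1 hA).1 (abs_le.1 hA).2
  have hsqB := sq_le_sq' (abs_le.1 hB).1 (abs_le.1 hB).2
  have : (ZOmega.inorm x).natAbs = ZOmega.inorm x := by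
    rw [Int.natAbs_of_nonneg]; rw [e]; positivity
  have hle : ZOmega.inorm x ≤ 32 * (c : ℤ) ^ 4 := by rw [e]; nlinarith
  exact_mod_cast (show ((ZOmega.inorm x).natAbs : ℤ) ≤ 32 * (c : ℤ) ^ 4 by rw [this]; exact hle)

/-- `r! ≤ 2^{r²}`. [folklore] -/
theorem factorial_le_two_pow_sq (r : ℕ) : r.factorial ≤ 2 ^ (r * r) := by
  induction r with
  | zero => simp
  | succ r ih =>
    rw [Nat.factorial_succ]
    calc (r + 1) * r.factorial ≤ 2 ^ (r + 1) * 2 ^ (r * r) := Nat.mul_le_mul Nat.lt_two_pow_self.le ih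
      _ = 2 ^ (r + 1 + r * r) := by rw [← pow_add]
      _ ≤ 2 ^ ((r + 1) * (r + 1)) := Nat.pow_le_pow_right (by norm_num) (by nlinarith)

/-! #### Codes -/

/-- The code of an element of `ℤ[ω]`: its four integer coordinates as two Gaussian pairs. [folklore] -/
def zoE : ZOmega → List Bool := fun x => pairE zgE zgE ((x.p.re, x.p.im), (x.q.re, x.q.im))

/-- The code of an advice item. [folklore] -/
def itemE : List GateCode × (List Bool × ZOmega) → List Bool := pairE (rawE gcE) (pairE bitsE zoE)

/-- **The code of an advice datum.** [folklore] -/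
def advE : Core.AdvDatum → List Bool := fun a =>
  pairE unE (pairE bitsE (pairE bitsE (pairE (rawE itemE) (pairE zoE (pairE zoE (pairE intE unE))))))
    (a.tail0, a.base, a.finTail, a.items, a.mult, a.coden, a.nrm, a.rho)

/-- The code of a bit list has length `4 |l|`. [folklore] -/
theorem length_bitsE (l : List Bool) : (bitsE l).length = 4 * l.length := by
  rw [show bitsE l = rawE bitE l from rfl, length_rawE]
  induction l with
  | nil => simp
  | cons b l ih => simp [bitE] at ih ⊢; omega

/-- The code of an integer pair with `|coords| ≤ 2^m`. [folklore] -/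
theorem length_zgE_le {a b : ℤ} {m : ℕ} (ha : a.natAbs ≤ 2 ^ m) (hb : b.natAbs ≤ 2 ^ m) :
    (zgE (a, b)).length ≤ 9 * m + 17 := by
  rw [show zgE (a, b) = boolPair (intE a) (intE b) from rfl, length_boolPair]
  have := length_intE_le_of_natAbs_le ha
  have := length_intE_le_of_natAbs_le hb
  omega

/-- The code of an element of `ℤ[ω]` with `cn ≤ 2^m`. [folklore] -/
theorem length_zoE_le {x : ZOmega} {m : ℕ} (h : ZOmega.cn x ≤ 2 ^ m) : (zoE x).length ≤ 27 * m + 53 := by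
  obtain ⟨h1, h2, h3, h4⟩ := ZOmega.cn_le_iff.1 h
  rw [zoE, pairE_apply, length_boolPair]
  show 2 * (zgE (x.p.re, x.p.im)).length + 2 + (zgE (x.q.re, x.q.im)).length ≤ _
  have := length_zgE_le h1 h2
  have := length_zgE_le h3 h4
  omega

/-- The code of a small gate code. [folklore] -/
theorem length_gcE_le (g : GateCode) (W : ℕ) (hs : g.2.1 ≤ 3) (hl : g.2.2.length ≤ 2) (hw : ∀ w ∈ g.2.2, w ≤ W) :
    (gcE g).length ≤ 4 * W + 20 := by
  rw [gcE]
  simp only [List.length_cons, pairE_apply, length_boolPair]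
  rw [show listE natE g.2.2 = boolPair (unE g.2.2.length) (rawE natE g.2.2) from rfl, length_boolPair, length_unE]
  have h1 := length_natE_le g.2.1
  have h2 := length_rawE_le_of_forall natE g.2.2 W fun w hw' => (length_natE_le w).trans (hw w hw')
  nlinarith
set_option maxHeartbeats 400000 in -- buildfix (bf3-g27): 160k/180k FAIL, 200k PASS at accept time; line-neutral budget line
/-- **The size of the code of an advice datum** in terms of a common bound `B` on its list lengths,
small naturals and wire indices and a common bit bound `m` on its integers: `≤ 1000 (B + m + 20)³`.
[folklore] -/
theorem length_advE_le (a : Core.AdvDatum) (B m : ℕ) (h0 : a.tail0 ≤ B) (h1 : a.base.length ≤ B)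
    (h2 : a.finTail.length ≤ B) (h3 : a.items.length ≤ B)
    (h4 : ∀ it ∈ a.items, it.1.length ≤ B ∧ (∀ g ∈ it.1, g.2.1 ≤ 3 ∧ g.2.2.length ≤ 2 ∧ ∀ w ∈ g.2.2, w ≤ B) ∧
      it.2.1.length ≤ B ∧ ZOmega.cn it.2.2 ≤ 2 ^ m)
    (h5 : ZOmega.cn a.mult ≤ 2 ^ m) (h6 : ZOmega.cn a.coden ≤ 2 ^ m) (h7 : a.nrm.natAbs ≤ 2 ^ m) (h8 : a.rho ≤ B) :
    (advE a).length ≤ 1000 * (B + m + 20) ^ 3 := by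
  set K := B + m + 20 with hK
  have hB : B ≤ K := by omega
  have hm : m ≤ K := by omega
  have hK1 : 20 ≤ K := by omega
  have hitem : ∀ it ∈ a.items, (itemE it).length ≤ 112 * K ^ 2 := by
    intro it hit
    obtain ⟨hl, hg, ht, hc⟩ := h4 it hit
    have e1 : (rawE gcE it.1).length ≤ it.1.length * (2 * (4 * B + 20) + 2) :=
      length_rawE_le_of_forall gcE it.1 (4 * B + 20) fun g hg' => by
        obtain ⟨x1, x2, x3⟩ := hg g hg'
        exact length_gcE_le g B x1 x2 x3
    have e2 := length_bitsE it.2.1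
    have e3 := length_zoE_le hc
    rw [itemE, pairE_apply, length_boolPair, pairE_apply, length_boolPair]
    have e1' : (rawE gcE it.1).length ≤ K * (10 * K) := e1.trans (Nat.mul_le_mul (hl.trans hB) (by omega))
    nlinarith
  have eitems : (rawE itemE a.items).length ≤ a.items.length * (2 * (112 * K ^ 2) + 2) :=
    length_rawE_le_of_forall itemE a.items _ hitem
  have eitems' : (rawE itemE a.items).length ≤ K * (226 * K ^ 2) :=
    eitems.trans (Nat.mul_le_mul (h3.trans hB) (by nlinarith))
  have et := length_unE a.tail0
  have eb := length_bitsE a.base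
  have ef := length_bitsE a.finTail
  have emu := length_zoE_le h5
  have eco := length_zoE_le h6
  have enr := length_intE_le_of_natAbs_le h7
  have erh := length_unE a.rho
  unfold advE
  simp only [pairE_apply, length_boolPair]
  have hK2 : K ≤ K ^ 2 := by nlinarith
  have hK3 : K ^ 2 ≤ K ^ 3 := by nlinarith
  nlinarith

end SharpPHT

end Literature.Computability.QuantumComplexity

/-! ### The size of the advice datum of a length is polynomial -/

namespace Literature.Computability.QuantumComplexity

namespace SharpPHT

namespace Core

open _root_.Computability Cryptography Matrix Complex BravyiGosset StabilizerFormalism Complexity RevClean RevSim CWrap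
  Literature.Computability.Complexity.CodeFP Polynomial

variable (Q : Core)

/-- The number of gates of the core circuit. [folklore] -/
def sN (n : ℕ) : ℕ := (Q.circ n).gates.length

/-- `t ≤ s`. [folklore] -/
theorem tN_le_sN (n : ℕ) : Q.tN n ≤ Q.sN n := List.countP_le_length

/-- The gate count: `s = ρ + |revCompile| + (ρ + A₁)`. [folklore] -/
theorem sN_eq (n : ℕ) : Q.sN n = Q.rho n + ((revCompile (Q.clamp n)).length + (Q.rho n + A₁ Q.M)) := by
  unfold sN circ
  simp [PPPostBQP.Core.hGates, coinWires, h2Wires, resWires, resLen]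

/-- The clamped program has as many operations as the clean block. [folklore] -/
theorem length_clamp (n : ℕ) : (Q.clamp n).length = (Q.prog n).length := by
  unfold clamp; rw [length_toRevList, List.length_map]

/-- **The gate count is polynomial**: `s ≤ 2ρ + A₁ + 24 · cleanLenPoly(nT n)`. [cite: AroraBarak2009, Remark 6.7] -/
theorem sN_le (n : ℕ) : Q.sN n ≤ 2 * Q.rho n + A₁ Q.M + 24 * (cleanLenPoly Q.e Q.M).eval (Q.nT n) := by
  rw [sN_eq]
  have h1 := length_revCompile_le (Q.clamp n)
  rw [length_clamp] at h1
  have h2 : (Q.prog n).length ≤ (cleanLenPoly Q.e Q.M).eval (Q.nT n) := by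
    unfold prog nT
    exact length_cleanOps_le_eval Q.e Q.M (Q.n0 n) (vg n)
  omega

/-- The components of the codes of the merged list. [folklore] -/
theorem mList_codes_small (n : ℕ) (i : Fin (Q.rN n)) :
    ∀ g ∈ (Q.mList n i).map gateTriple, g.2.1 ≤ 3 ∧ g.2.2.length ≤ 2 ∧ ∀ w ∈ g.2.2, w < Q.NW n + Q.tN n + Q.tN n := by
  intro g hg
  obtain ⟨g', hg', rfl⟩ := List.mem_map.1 hg
  exact gateTriple_small g' (Q.mList_isOracleFree n i g' hg')

/-- The length of the merged list. [folklore] -/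
theorem length_mList_le (n : ℕ) (i : Fin (Q.rN n)) : (Q.mList n i).length ≤ Q.tN n * (4 * Q.tN n + 5) + Q.sN n := by
  unfold mList
  rw [List.length_append, List.length_map, List.length_map, (Q.cList_spec' n).2.2.1]
  exact Nat.add_le_add_right (length_allGadgets_le _) _

/-- The list bound `B(n)`. [folklore] -/
def BB (n : ℕ) : ℕ := Q.NW n + Q.tN n * (4 * Q.tN n + 5) + Q.sN n + Q.rN n + 2 * Q.tN n + Q.rho n

/-- The exponent `m₁(n)` bounding Cramer's coefficients: `r² + 2r + t(4t+5) r`. [folklore] -/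
def m1 (n : ℕ) : ℕ := Q.rN n * Q.rN n + 2 * Q.rN n + Q.tN n * (4 * Q.tN n + 5) * Q.rN n

/-- The exponent `m_den(n)` bounding the denominator: `4 + W + 2 h_C + m₁`. [folklore] -/
def mden (n : ℕ) : ℕ := 4 + (Q.NW n + Q.tN n + Q.tN n) + 2 * Q.sN n + Q.m1 n

/-- The bit bound `m(n)`. [folklore] -/
def mm (n : ℕ) : ℕ := 5 + 4 * Q.mden n + (2 + Q.rho n + 2 * A₁ Q.M)

/-- Cramer's bound is at most `2^{m₁}`. [folklore] -/
theorem cramer_le_two_pow_m1 (n : ℕ) :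
    (Q.rN n).factorial * (4 ^ Q.rN n * (2 ^ (Q.tN n * (4 * Q.tN n + 5))) ^ Q.rN n) ≤ 2 ^ Q.m1 n := by
  have h4 : (4 : ℕ) ^ Q.rN n = 2 ^ (2 * Q.rN n) := by rw [pow_mul]; norm_num
  have hT : (2 ^ (Q.tN n * (4 * Q.tN n + 5))) ^ Q.rN n = 2 ^ (Q.tN n * (4 * Q.tN n + 5) * Q.rN n) := by rw [← pow_mul]
  calc (Q.rN n).factorial * (4 ^ Q.rN n * (2 ^ (Q.tN n * (4 * Q.tN n + 5))) ^ Q.rN n)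
      ≤ 2 ^ (Q.rN n * Q.rN n) * (4 ^ Q.rN n * (2 ^ (Q.tN n * (4 * Q.tN n + 5))) ^ Q.rN n) :=
        Nat.mul_le_mul_right _ (factorial_le_two_pow_sq _)
    _ = 2 ^ Q.m1 n := by rw [h4, hT, ← pow_add, ← pow_add, m1, add_assoc]

/-- `cn (2^k) = 2^k` in `ℤ[ω]`. [folklore] -/
theorem cn_two_pow (k : ℕ) : ZOmega.cn ((2 : ZOmega) ^ k) = 2 ^ k := by
  rw [show ((2 : ZOmega) ^ k) = ((2 ^ k : ℕ) : ZOmega) by push_cast; rfl, cn_natCast]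

/-- The denominator bound. [folklore] -/
theorem cn_den_le (n : ℕ) : ZOmega.cn (Q.den n) ≤ 2 ^ Q.mden n := by
  have hD := (Q.decomp_spec n).2.2.2.2.1.trans (Q.cramer_le_two_pow_m1 n)
  have hC : hCount (Q.cList n) ≤ Q.sN n := (hCount_le_length _).trans (le_of_eq (Q.cList_spec' n).2.2.1)
  unfold den mden
  calc ZOmega.cn (Q.DD n * 2 ^ (Q.NW n + Q.tN n + Q.tN n) * sq2Z ^ hCount (Q.cList n))
      ≤ 4 * (ZOmega.cn (Q.DD n * 2 ^ (Q.NW n + Q.tN n + Q.tN n)) * ZOmega.cn (sq2Z ^ hCount (Q.cList n))) := ZOmega.cn_mul_le _ _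
    _ ≤ 4 * ((4 * (ZOmega.cn (Q.DD n) * ZOmega.cn ((2 : ZOmega) ^ (Q.NW n + Q.tN n + Q.tN n)))) * (4 ^ hCount (Q.cList n) * ZOmega.cn sq2Z ^ hCount (Q.cList n))) :=
        Nat.mul_le_mul_left _ (Nat.mul_le_mul (ZOmega.cn_mul_le _ _) (cn_pow_le _ _))
    _ = 4 * (4 * (ZOmega.cn (Q.DD n) * 2 ^ (Q.NW n + Q.tN n + Q.tN n)) * 4 ^ hCount (Q.cList n)) := by
        rw [cn_two_pow, cn_sq2Z, one_pow, mul_one]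
    _ ≤ 4 * (4 * (2 ^ Q.m1 n * 2 ^ (Q.NW n + Q.tN n + Q.tN n)) * 4 ^ Q.sN n) := by gcongr; norm_num
    _ = 2 ^ (4 + (Q.NW n + Q.tN n + Q.tN n) + 2 * Q.sN n + Q.m1 n) := by
        rw [show (4 : ℕ) = 2 ^ 2 by norm_num, ← pow_mul]; ring

/-- All components of the advice datum are bounded by `B(n)` and `2^{m(n)}`. [folklore] -/
theorem advOf_bounds (n : ℕ) :
    (Q.advOf n).tail0 ≤ Q.BB n ∧ (Q.advOf n).base.length ≤ Q.BB n ∧ (Q.advOf n).finTail.length ≤ Q.BB n ∧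
      (Q.advOf n).items.length ≤ Q.BB n ∧
      (∀ it ∈ (Q.advOf n).items, it.1.length ≤ Q.BB n ∧
        (∀ g ∈ it.1, g.2.1 ≤ 3 ∧ g.2.2.length ≤ 2 ∧ ∀ w ∈ g.2.2, w ≤ Q.BB n) ∧
        it.2.1.length ≤ Q.BB n ∧ ZOmega.cn it.2.2 ≤ 2 ^ Q.mm n) ∧
      ZOmega.cn (Q.advOf n).mult ≤ 2 ^ Q.mm n ∧ ZOmega.cn (Q.advOf n).coden ≤ 2 ^ Q.mm n ∧
      (Q.advOf n).nrm.natAbs ≤ 2 ^ Q.mm n ∧ (Q.advOf n).rho ≤ Q.BB n := by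
  have hanc : Q.anc n ≤ Q.NW n := Nat.le_add_left _ _
  have hBW : Q.NW n ≤ Q.BB n := by unfold BB; omega
  have hden := Q.cn_den_le n
  have hm1 : Q.m1 n ≤ Q.mm n := by unfold mm mden; omega
  have hmd : Q.mden n ≤ Q.mm n := by unfold mm; omega
  have h2 : (2 : ℕ) ≤ 2 ^ 1 := le_rfl
  refine ⟨hanc.trans hBW, ?_, ?_, ?_, ?_, ?_, ?_, ?_, ?_⟩
  · show (Q.base n).length ≤ _; rw [base, List.length_ofFn]; exact hanc.trans hBW
  · show (List.replicate (Q.tN n) false ++ List.replicate (Q.tN n) false).length ≤ _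
    simp only [List.length_append, List.length_replicate]; unfold BB; omega
  · show (List.ofFn _).length ≤ _; rw [List.length_ofFn]; unfold BB; omega
  · intro it hit
    change it ∈ List.ofFn _ at hit
    rw [List.mem_ofFn] at hit
    obtain ⟨i, rfl⟩ := hit
    refine ⟨?_, ?_, ?_, ?_⟩
    · show ((Q.mList n i).map gateTriple).length ≤ _
      rw [List.length_map]; refine (Q.length_mList_le n i).trans ?_; unfold BB; omega
    · intro g hg
      obtain ⟨x1, x2, x3⟩ := Q.mList_codes_small n i g hg
      exact ⟨x1, x2, fun w hw => (x3 w hw).le.trans (by unfold BB; omega)⟩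
    · show (List.ofFn (Q.zD n i) ++ List.replicate (Q.tN n) false).length ≤ _
      rw [List.length_append, List.length_ofFn, List.length_replicate]; unfold BB; omega
    · exact ((Q.decomp_spec n).2.2.2.2.2 i).trans ((Q.cramer_le_two_pow_m1 n).trans (Nat.pow_le_pow_right (by norm_num) hm1))
  · -- `mult = 2^ρ √2^{A₁}`
    show ZOmega.cn (Q.mult n) ≤ _
    unfold mult
    calc ZOmega.cn (2 ^ Q.rho n * sq2Z ^ A₁ Q.M) ≤ 4 * (ZOmega.cn ((2 : ZOmega) ^ Q.rho n) * ZOmega.cn (sq2Z ^ A₁ Q.M)) := ZOmega.cn_mul_le _ _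
      _ ≤ 4 * (2 ^ Q.rho n * (4 ^ A₁ Q.M * ZOmega.cn sq2Z ^ A₁ Q.M)) := by rw [cn_two_pow]; exact Nat.mul_le_mul_left _ (Nat.mul_le_mul_left _ (cn_pow_le _ _))
      _ = 2 ^ (2 + Q.rho n + 2 * A₁ Q.M) := by rw [cn_sq2Z, one_pow, mul_one, show (4 : ℕ) = 2 ^ 2 by norm_num, ← pow_mul]; ring
      _ ≤ 2 ^ Q.mm n := Nat.pow_le_pow_right (by norm_num) (by unfold mm; omega)
  · -- `coden`
    show ZOmega.cn (Q.coden n) ≤ _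
    unfold coden
    calc ZOmega.cn (ZOmega.conj5 (Q.den n) * ZOmega.starP (Q.den n * ZOmega.conj5 (Q.den n)))
        ≤ 4 * (ZOmega.cn (ZOmega.conj5 (Q.den n)) * ZOmega.cn (ZOmega.starP (Q.den n * ZOmega.conj5 (Q.den n)))) := ZOmega.cn_mul_le _ _
      _ ≤ 4 * (ZOmega.cn (Q.den n) * (4 * (ZOmega.cn (Q.den n) * ZOmega.cn (Q.den n)))) := by
          rw [cn_conj5]
          refine Nat.mul_le_mul_left _ (Nat.mul_le_mul_left _ ((cn_starP_le _).trans ?_))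
          exact (ZOmega.cn_mul_le _ _).trans (by rw [cn_conj5])
      _ ≤ 4 * (2 ^ Q.mden n * (4 * (2 ^ Q.mden n * 2 ^ Q.mden n))) := by gcongr
      _ = 2 ^ (4 + 3 * Q.mden n) := by rw [show (4 : ℕ) = 2 ^ 2 by norm_num, ← pow_add, ← pow_add, ← pow_add, ← pow_add]; ring_nf
      _ ≤ 2 ^ Q.mm n := Nat.pow_le_pow_right (by norm_num) (by unfold mm; omega)
  · -- `nrm`
    show (Q.nrm n).natAbs ≤ _
    unfold nrm
    calc (ZOmega.inorm (Q.den n)).natAbs ≤ 32 * ZOmega.cn (Q.den n) ^ 4 := natAbs_inorm_le _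
      _ ≤ 32 * (2 ^ Q.mden n) ^ 4 := by gcongr
      _ = 2 ^ (5 + 4 * Q.mden n) := by rw [show (32 : ℕ) = 2 ^ 5 by norm_num, ← pow_mul, ← pow_add]; ring_nf
      _ ≤ 2 ^ Q.mm n := Nat.pow_le_pow_right (by norm_num) (by unfold mm; omega)
  · show Q.rho n ≤ _; unfold BB; omega

/-- **The code of the advice datum of length `n` has size `≤ 1000 (B(n) + m(n) + 20)³`.** [folklore] -/
theorem length_advE_advOf_le (n : ℕ) : (advE (Q.advOf n)).length ≤ 1000 * (Q.BB n + Q.mm n + 20) ^ 3 := by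
  obtain ⟨h0, h1, h2, h3, h4, h5, h6, h7, h8⟩ := Q.advOf_bounds n
  exact length_advE_le _ _ _ h0 h1 h2 h3 h4 h5 h6 h7 h8

/-! #### As a polynomial in `n` (under the polynomial-rank hypothesis) -/

/-- `nT` as a polynomial. [folklore] -/
def nTotPoly : Polynomial ℕ := X + Q.p + (2 * X + 2)

/-- Value of `nTotPoly`. [folklore] -/
@[simp] theorem eval_nTotPoly (n : ℕ) : Q.nTotPoly.eval n = Q.nT n := by
  simp [nTotPoly, nT, n0, rho, length_vg]

/-- An upper bound for `s` as a polynomial. [folklore] -/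
def sPoly : Polynomial ℕ := 2 * Q.p + C (A₁ Q.M) + 24 * (cleanLenPoly Q.e Q.M).comp Q.nTotPoly

/-- `s ≤ sPoly`. [folklore] -/
theorem sN_le_eval (n : ℕ) : Q.sN n ≤ Q.sPoly.eval n := by
  have := Q.sN_le n
  simp only [sPoly, eval_add, eval_mul, eval_ofNat, eval_C, eval_comp, eval_nTotPoly]
  unfold rho at this; exact this

/-- `W = NW` as a polynomial. [folklore] -/
def WPoly : Polynomial ℕ := (widthPoly Q.e Q.M).comp Q.nTotPoly

/-- Value of `WPoly`. [folklore] -/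
theorem eval_WPoly (n : ℕ) : Q.WPoly.eval n = Q.NW n := by
  rw [WPoly, eval_comp, eval_nTotPoly, eval_widthPoly, NW, n_add_anc]; rfl

variable {Q}

/-- **Polynomial size of the advice** under a polynomial bound `χ(|T⟩^{⊗m}) ≤ m^c + c` on the exact
stabilizer rank of the magic states. [cite: MehrabanTahmasbi2024, proof of Theorem 1.6 ("polynomial in n number bits of advice")] -/
theorem exists_poly_length_advE {c : ℕ} (hχ : ∀ m : ℕ, stabilizerRank (tensorPow magicT m) ≤ m ^ c + c) :
    ∃ P : Polynomial ℕ, ∀ n : ℕ, (advE (Q.advOf n)).length ≤ P.eval n := by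
  -- polynomial bounds for `r`, `B`, `m₁`, `m_den`, `m`
  set sP := Q.sPoly with hsP
  set rP : Polynomial ℕ := sP ^ c + C c with hrP
  set TP : Polynomial ℕ := sP * (4 * sP + 5) with hTP
  set BP : Polynomial ℕ := Q.WPoly + TP + sP + rP + 2 * sP + Q.p with hBP
  set m1P : Polynomial ℕ := rP * rP + 2 * rP + TP * rP with hm1P
  set mdP : Polynomial ℕ := 4 + (Q.WPoly + sP + sP) + 2 * sP + m1P with hmdP
  set mmP : Polynomial ℕ := 5 + 4 * mdP + (2 + Q.p + C (2 * A₁ Q.M)) with hmmP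
  refine ⟨1000 * (BP + mmP + 20) ^ 3, fun n => (Q.length_advE_advOf_le n).trans ?_⟩
  have hs : Q.sN n ≤ sP.eval n := Q.sN_le_eval n
  have ht : Q.tN n ≤ sP.eval n := (Q.tN_le_sN n).trans hs
  have hr : Q.rN n ≤ rP.eval n := by
    have := hχ (Q.tN n)
    rw [hrP, eval_add, eval_pow, eval_C]
    exact (show Q.rN n ≤ Q.tN n ^ c + c from this).trans (Nat.add_le_add_right (Nat.pow_le_pow_left ht _) _)
  have hT : Q.tN n * (4 * Q.tN n + 5) ≤ TP.eval n := by
    rw [hTP, eval_mul, eval_add, eval_mul, eval_ofNat, eval_ofNat]; gcongr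
  have hW : Q.NW n = Q.WPoly.eval n := (Q.eval_WPoly n).symm
  have hρ : Q.rho n = Q.p.eval n := rfl
  have hB : Q.BB n ≤ BP.eval n := by
    unfold BB
    rw [hBP]; simp only [eval_add, eval_mul, eval_ofNat]
    rw [← hW, ← hρ]; gcongr
  have hm1 : Q.m1 n ≤ m1P.eval n := by
    unfold m1; rw [hm1P]; simp only [eval_add, eval_mul, eval_ofNat]; gcongr
  have hmd : Q.mden n ≤ mdP.eval n := by
    unfold mden; rw [hmdP]; simp only [eval_add, eval_mul, eval_ofNat]; rw [← hW]; gcongr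
  have hmm : Q.mm n ≤ mmP.eval n := by
    unfold mm; rw [hmmP]; simp only [eval_add, eval_mul, eval_ofNat, eval_C]; rw [← hρ]; gcongr
  simp only [eval_mul, eval_pow, eval_add, eval_ofNat]
  gcongr

/-- **The advice theorem.** Under `χ(|T⟩^{⊗m}) ≤ m^c + c`: for the Hadamard-test core `Q` of a
`#P` relation there is a polynomial `P` such that for every length `n` the advice datum `advOf Q n`
has a code of length `≤ P(n)` and evaluates — through the exact polynomial-time Clifford amplitude
evaluator `ampValOf` on its items and the closed formula `countOf` — to the witness count
`#{w ∈ {0,1}^{p(n)} | ⟨y, w⟩ ∈ R}` of every query `y` of length `n`. This is the content of the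
printed proof of Mehraban–Tahmasbi 2024, Thm. 1.6 ("if `χ(T^{⊗m}) = poly(m)`, there exists a
polynomial-time algorithm with polynomial advice … for the problem of computing the gap").
[cite: MehrabanTahmasbi2024, Theorem 1.6 (proof, arXiv p. 5–6)] -/
theorem advice_spec {c : ℕ} (hχ : ∀ m : ℕ, stabilizerRank (tensorPow magicT m) ≤ m ^ c + c) :
    ∃ P : Polynomial ℕ, ∀ n : ℕ, (advE (Q.advOf n)).length ≤ P.eval n ∧
      ∀ y : List Bool, y.length = n → (Q.advOf n).eval y = countWitnesses Q.R (Q.rho n) y := by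
  obtain ⟨P, hP⟩ := exists_poly_length_advE (Q := Q) hχ
  refine ⟨P, fun n => ⟨hP n, fun y hy => ?_⟩⟩
  subst hy
  exact Q.eval_advOf y

end Core

end SharpPHT

end Literature.Computability.QuantumComplexity

end
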